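import Literature.NumberTheory.LFunctions.RealZerosRealLFunctionsElementary
import Literature.NumberTheory.LFunctions.RealCharacterDivisorSums
import Literature.NumberTheory.LFunctions.DirichletLOneTail
import Literature.NumberTheory.LFunctions.ZetaRealAxis
import Literature.NumberTheory.LFunctions.SiegelTheorem
import Mathlib.NumberTheory.LSeries.SumCoeff
import Mathlib.NumberTheory.Harmonic.ZetaAsymp
import Mathlib.NumberTheory.AbelSummation
import Mathlib.Analysis.Calculus.ParametricIntegral
import Mathlib.Analysis.SpecialFunctions.ImproperIntegrals
import Mathlib.Analysis.Complex.Convex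
import Mathlib.MeasureTheory.Function.Floor
import HarnessLib

/-!
# Pintz 1977 (VIII), Theorem 4 — Page's theorem with `c = 2 + o(1)` — PROVED, with Pintz's
# Lemmata 2–3 (the elementary continuation of `ζ(s)·L`-products) as a re-usable engine

Topic `Literature/NumberTheory/LFunctions` (namespace `Literature.NumberTheory.LFunctions`, helpers
in the grouping sub-namespace `Pintz1977RealZeros`). PROOF LAYER for the statement file
`RealZerosRealLFunctionsElementary.lean` (cells `parity-realchar` / `landau-siegel` §C); companion of
`RealZerosRealLFunctionsElementaryProofs.lean` (Theorem 2, Hecke). The named fact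

* `pintz1977RealZeros_theorem4` — J. Pintz, *Elementary methods in the theory of `L`-functions,
  VIII. Real zeros of real `L`-functions*, Acta Arith. **33** (1977) 89–98, Theorem 4 (Page): "If `χ`
  is a real non-principal character `(mod D)`, then `L(s, χ)` has at most one, simple zero in the
  interval `[1 − c/log D, 1]` where … `c = 2 + o(1)` if we use [the Pólya–Vinogradov inequality]"
  (typed: for every `η > 0` there is `D₀` such that for `D ≥ D₀` two distinct real zeros have
  `min ≤ 1 − (2 − η)/log D`, and a real zero `β ≥ 1 − (2 − η)/log D` has `L′(β, χ) ≠ 0`)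

is discharged here as `theorem pintz1977RealZeros_theorem4_holds : pintz1977RealZeros_theorem4`.
The statement file is untouched; the typed `Prop` is proved literally. Everything in this file is
PROVED (theorems only; no definition, no named fact).

## Source and road (as printed, §3 Lemmata 1–3 and §4, pp. 91–96)

Source READ first-hand in the proving seat: the journal scan `matwbn.icm.edu.pl/ksiazki/aa/aa33/aa3318.pdf`
(corpus `paper:url-e87e20b34ffd`, image-only; the six two-page images rendered as
`pintz/page01–12.png`; Theorem 4 p. 90, Lemma 1 pp. 91–93, Lemma 2 pp. 93–94 (3.11)–(3.15), Lemma 3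
p. 94 (3.16), proof of Theorems 4–5 p. 96 (4.5)).

PRINT (p. 96): "If the function `F(s)` satisfies the conditions of Lemma 3, further `a > 0`,
`f(m) ≥ 0` and `f(4) ≥ 1`, then `F(s)` has at most one, simple zero in the interval
`[1 − (1 − o(1))/log A, 1]`. Namely, if we choose `x = A^{1+ε}` … and if `1 − 1/log x ≤ s ≤ 1`, then
the error term in Lemma 3 is `o(1)`, so we have by (3.16):
`F′(s) = −∑_{m≤x} f(m) log m/m^s − (a/(1−s)) x^{1−s}(1/(1−s) − log x) + o(1) ≤ −log 4/4 + o(1) < 0`.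
Applying this for `F(s) = F(s, χ)` we get Theorem 4 (… in case of the Pólya–Vinogradov inequality
`A = 2√D log D` with `c = 2 + o(1)`)."

HERE, in the same order:

* **Part A (Lemma 2).** For `f ≥ 0` with summatory function `H(t) = ∑_{k ≤ t} f(k) = a t + R(t)`,
  `|R(t)| ≤ B₀ t^{1−κ}`: the remainder integral `I(s) = ∫_1^∞ R(t) t^{−s−1} dt` converges absolutely
  and is holomorphic on `Re s > 1 − κ` (differentiation under the integral sign,
  `hasDerivAt_remainderIntegral`); `∑ f(m) m^{−s} = a s/(s−1) + s I(s)` for `Re s > 1`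
  (`LSeries_eq_residue_add`, partial summation = the printed (3.13)–(3.14)); hence any holomorphic `G`
  on the half-plane with `G = (s−1)·∑ f(m)m^{−s}` on `Re s > 1` satisfies `G(s) = a s + s(s−1) I(s)`
  there (`continuation_eq`, identity theorem) — the printed "`F(s)` can be analytically continued in the
  half-plane `σ > 1 − 1/(j+1)` except a single pole in `s = 1`".
* **Part B (Lemma 3 and (4.5)).** On the real axis, `Φ(s) = a s/(s−1) + s I(s)` has
  `Re Φ′(σ) = −∑_{k≤N} f(k) k^{−σ} log k − a N^{1−σ}(1/(1−σ)² − log N/(1−σ)) + R(N)N^{−σ} log N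
   + ∫_N^∞ R(t) t^{−σ−1}(1 − σ log t) dt` for every natural `N` (`re_deriv_eq`: finite Abel summation
  on `[1, N]` against the weight `t^{−σ} log t`, Mathlib `sum_mul_eq_sub_integral_mul₀'` — this is
  footnote (2) p. 94, "directly from (3.11) applying the same method as in Lemma 2", instead of the
  Cauchy inequality), and `Re Φ′(σ) ≤ −log 4/4 + B N^{−α}(log N + 1/α + σ(log N/α + 1/α²))`,
  `α = σ + κ − 1`, on `[1 − 1/log N, 1)` when `|R(t)| ≤ B t^{1−κ}` for `t ≥ N` (`re_deriv_le`);
  Rolle for `σ ↦ Re F(σ)` gives at most one real zero (`eq_of_zeros_of_re_deriv_neg`).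
* **Part C (Lemma 1, `j = 1`).** Dirichlet's hyperbola method with a partial-sum bound `A`:
  `|∑_{n ≤ t} (1 ∗ χ)(n) − L(1,χ) t| ≤ 5 √(A t)` for `t ≥ A` (= the printed (3.9)); with the tree's
  Pólya–Vinogradov inequality (`LargeSieve.polyaVinogradov`) `A = √q (1 + log q)`.
* **Part D (§4 for `F = ζ·L`).** `ζ(s)L(s, χ) = ∑ (1∗χ)(n) n^{−s}` (Mathlib's `zetaMul`),
  `G = ζ₁ · L(χ)` entire (`riemannZeta₁ = (s−1)ζ(s)` completed), `(1∗χ)(4) = 1 + χ(2) + χ(2)² ≥ 1`,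
  `a = L(1, χ) > 0`: for a real primitive `χ` mod `q ≥ 2` and `N ≥ 55`, `N ≥ A`,
  `25 e √A (log N + 4) < (log 4/4) √N`, the function `L(s, χ)` has at most one zero on
  `[1 − 1/log N, 1)` and it is simple (`page_window_of_isPrimitive`; simplicity from
  `(ζL)′(β) = ζ(β) L′(β)` at a zero and `Re (ζL)′(β) < 0`).
* **Part E–F (Theorem 4).** The printed reduction of a non-principal `χ` mod `D` to the primitive
  character inducing it (p. 90: "`L(s, χ)` and `L(s, χ₁)` have the same zeros for `Re s > 0`";
  Mathlib `primitiveCharacter`, `LFunction_changeLevel`; the removed Euler factors do not vanish at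
  real `β > 0`, so zeros AND the non-vanishing of `L′` at a zero transfer), the choice
  `N = ⌊D^{1/(2−η)}⌋` (so that `1/log N ≥ (2−η)/log D`) and the elementary limits
  `(1 + log x)/x^u → 0` giving `D₀(η)`.

DECLARED DEVIATIONS from print: (i) the window is parametrised by `N` with `1/log N` in place of
`x = A^{1+ε}` — the same inequality (4.5); (ii) the partial-sum bound is the tree's explicit
`√q (1 + log q)` rather than `2√D log D` (any `A ≍ √D log D` gives `c = 2 + o(1)`); (iii) the error of
Lemma 1 is carried with the explicit constant `5√(A t)` and the errors of Lemmata 2–3 with explicit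
majorants (no `O`-symbols); (iv) `D₀(η)` is obtained from limits, not computed. No constant of the
printed statement is changed: `c = 2 + o(1)` is proved exactly as typed (`∀ η > 0 ∃ D₀`).

Re-usable for the remaining theorems of the paper: Parts A–B are stated for an arbitrary
non-negative `f` with a power-saving remainder (Lemma 2/3 for `F(s) = ζ(s)L(s,χ₁)L(s,χ₂)L(s,χ₁χ₂)`,
`j = 3`, is the case `κ = 1/4` once Lemma 1 for `j = 3` supplies `R`).

WHAT THIS IS NOT: no claim that any real zero exists or does not exist; nothing here bears on parity
or on Landau–Siegel zeros beyond Page's classical theorem. «The programme SEARCHES and TYPES; no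
claim about Landau–Siegel zeros, Theorems 1–2 of arXiv:2211.02515 or a repaired Margin232 until a
kernel theorem says so.»

## References

* [Pintz1977ElementaryVIII] J. Pintz, Acta Arith. 33 (1977) 89–98: Theorem 4 p. 90; Lemma 1
  (3.1)–(3.10) pp. 91–93; Lemma 2 (3.11)–(3.15) pp. 93–94; Lemma 3 (3.16) p. 94; §4 pp. 94–96, (4.5).
* [MontgomeryVaughan2007] H. L. Montgomery, R. C. Vaughan, *Multiplicative Number Theory I*, CUP
  2007: §1.3 (Abel summation), §4.3 (hyperbola method for `1 ∗ χ`), §9.4 (Pólya–Vinogradov),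
  §11.2.1 Exercise 3 (the `L(1, χ)` tail).
* [Titchmarsh1986] E. C. Titchmarsh, *The Theory of the Riemann Zeta-Function*, §2.1 (2.1.4) — the
  model for Part A (tree `ZetaFractionalPartIntegral.lean`).
-/

noncomputable section

open Complex Filter Topology Set MeasureTheory Finset Asymptotics

namespace Literature.NumberTheory.LFunctions

namespace Pintz1977RealZeros

/-! ## Part A. Pintz's Lemma 2: the remainder integral and the continuation identity

Throughout, `f : ℕ → ℝ` is a non-negative arithmetic function with summatory function
`H(t) = ∑_{1 ≤ k ≤ t} f(k) = a t + R(t)`, `|R(t)| ≤ B₀ t^{1−κ}` (`t ≥ 1`). The remainder is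
carried as a function `R : ℝ → ℝ` together with its defining identity `hR`, and the remainder
integral `I(s) = ∫_1^∞ R(t) t^{−s−1} dt` as a function `I : ℂ → ℂ` with its defining identity
`hI` (no definitions are introduced in this file). -/

section Engine

variable {f : ℕ → ℝ} {a B₀ κ : ℝ} {R : ℝ → ℝ} {I : ℂ → ℂ}

/-- Measurability of the summatory function `t ↦ ∑_{k ≤ t} f(k)`. [folklore] -/
private theorem measurable_summatory (f : ℕ → ℝ) :
    Measurable fun t : ℝ => ∑ k ∈ Icc 1 ⌊t⌋₊, f k :=
  (measurable_from_nat (f := fun n : ℕ => ∑ k ∈ Icc 1 n, f k)).comp Nat.measurable_floor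

/-- Measurability of the remainder `R(t) = ∑_{k ≤ t} f(k) − a t`. [folklore] -/
private theorem measurable_remainder (hR : ∀ t, R t = (∑ k ∈ Icc 1 ⌊t⌋₊, f k) - a * t) :
    Measurable R := by
  have : R = fun t => (∑ k ∈ Icc 1 ⌊t⌋₊, f k) - a * t := funext hR
  rw [this]
  exact (measurable_summatory f).sub (measurable_const.mul measurable_id)

/-- Measurability of the integrands `R(t) t^{w}` and `R(t) t^{w} log t`. [folklore] -/
private theorem measurable_remainder_mul_cpow (hR : ∀ t, R t = (∑ k ∈ Icc 1 ⌊t⌋₊, f k) - a * t)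
    (w : ℂ) : Measurable fun t : ℝ => ((R t : ℝ) : ℂ) * (t : ℂ) ^ w :=
  (measurable_ofReal.comp (measurable_remainder hR)).mul (measurable_ofReal.pow_const w)

/-- From the remainder bound at `t = 1`: `0 ≤ B₀`. [folklore] -/
private theorem remainderConst_nonneg (hRb : ∀ t : ℝ, 1 ≤ t → |R t| ≤ B₀ * t ^ (1 - κ)) : 0 ≤ B₀ := by
  have h := hRb 1 le_rfl
  rw [Real.one_rpow, mul_one] at h
  exact (abs_nonneg _).trans h

/-- Pointwise bound `‖R(t) t^{w}‖ ≤ B₀ t^{1 − κ + Re w}` for `t > 1`. [folklore] -/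
private theorem norm_remainder_mul_cpow_le (hRb : ∀ t : ℝ, 1 ≤ t → |R t| ≤ B₀ * t ^ (1 - κ))
    {t : ℝ} (ht : 1 ≤ t) (w : ℂ) :
    ‖((R t : ℝ) : ℂ) * (t : ℂ) ^ w‖ ≤ B₀ * t ^ (1 - κ + w.re) := by
  have ht0 : 0 < t := zero_lt_one.trans_le ht
  rw [norm_mul, Complex.norm_real, Real.norm_eq_abs, norm_cpow_eq_rpow_re_of_pos ht0,
    Real.rpow_add ht0, ← mul_assoc]
  exact mul_le_mul_of_nonneg_right (hRb t ht) (Real.rpow_nonneg ht0.le _)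

/-- **Absolute convergence of the remainder integral**: for `Re s > 1 − κ` the integrand
`R(t) t^{−s−1}` is integrable on `(1, ∞)`. [cite: Pintz1977ElementaryVIII, Lemma 2 (3.15) p. 94] -/
theorem integrableOn_remainder (hR : ∀ t, R t = (∑ k ∈ Icc 1 ⌊t⌋₊, f k) - a * t)
    (hRb : ∀ t : ℝ, 1 ≤ t → |R t| ≤ B₀ * t ^ (1 - κ)) {s : ℂ} (hs : 1 - κ < s.re) :
    IntegrableOn (fun t : ℝ => ((R t : ℝ) : ℂ) * (t : ℂ) ^ (-(s + 1))) (Ioi 1) := by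
  have hint : IntegrableOn (fun t : ℝ => B₀ * t ^ (-(s.re + κ))) (Ioi 1) :=
    (integrableOn_Ioi_rpow_of_lt (by linarith) zero_lt_one).const_mul B₀
  refine Integrable.mono' hint (measurable_remainder_mul_cpow hR _).aestronglyMeasurable ?_
  rw [ae_restrict_iff' measurableSet_Ioi]
  refine Eventually.of_forall fun t (ht : 1 < t) => ?_
  have h := norm_remainder_mul_cpow_le hRb ht.le (-(s + 1))
  have hre : 1 - κ + (-(s + 1)).re = -(s.re + κ) := by
    simp only [neg_add_rev, add_re, neg_re, one_re]; ring
  rwa [hre] at h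

/-- **Holomorphy of the remainder integral** (differentiation under the integral sign): for
`Re s₀ > 1 − κ`, `I(s) = ∫_1^∞ R(t) t^{−s−1} dt` has the derivative `∫_1^∞ R(t) t^{−s−1}(−log t) dt`
at `s₀`. [cite: Pintz1977ElementaryVIII, Lemma 2 p. 94 ("the third one is by (3.11) analytic for
σ > 1 − 1/(j+1)")] -/
theorem hasDerivAt_remainderIntegral (hR : ∀ t, R t = (∑ k ∈ Icc 1 ⌊t⌋₊, f k) - a * t)
    (hRb : ∀ t : ℝ, 1 ≤ t → |R t| ≤ B₀ * t ^ (1 - κ))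
    (hI : ∀ s, I s = ∫ t in Ioi (1 : ℝ), ((R t : ℝ) : ℂ) * (t : ℂ) ^ (-(s + 1)))
    {s₀ : ℂ} (hs₀ : 1 - κ < s₀.re) :
    IntegrableOn (fun t : ℝ => ((R t : ℝ) : ℂ) * ((t : ℂ) ^ (-(s₀ + 1)) * Complex.log t * (-1)))
        (Ioi 1) ∧
      HasDerivAt I
        (∫ t in Ioi (1 : ℝ), ((R t : ℝ) : ℂ) * ((t : ℂ) ^ (-(s₀ + 1)) * Complex.log t * (-1))) s₀ := by
  have hB₀ := remainderConst_nonneg hRb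
  set ε := s₀.re - (1 - κ) with hεdef
  have hε : 0 < ε := by rw [hεdef]; linarith
  have hball : Metric.ball s₀ (ε / 2) ∈ 𝓝 s₀ := Metric.ball_mem_nhds _ (by positivity)
  have hre : ∀ s ∈ Metric.ball s₀ (ε / 2), 1 - κ + ε / 2 < s.re := by
    intro s hs
    have h1 : |(s - s₀).re| ≤ ‖s - s₀‖ := abs_re_le_norm _
    have h2 : ‖s - s₀‖ < ε / 2 := by simpa [dist_eq_norm] using hs
    have h3 : |s.re - s₀.re| < ε / 2 := by simpa using h1.trans_lt h2
    have := (abs_lt.mp h3).1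
    rw [hεdef] at this ⊢; linarith
  set bound : ℝ → ℝ := fun t => (4 * B₀ / ε) * t ^ (-(1 + ε / 4)) with hbound
  have hIfun : I = fun s => ∫ t in Ioi (1 : ℝ), ((R t : ℝ) : ℂ) * (t : ℂ) ^ (-(s + 1)) := funext hI
  rw [hIfun]
  have key := hasDerivAt_integral_of_dominated_loc_of_deriv_le
    (μ := volume.restrict (Ioi (1 : ℝ)))
    (F := fun s t => ((R t : ℝ) : ℂ) * (t : ℂ) ^ (-(s + 1)))
    (F' := fun s t => ((R t : ℝ) : ℂ) * ((t : ℂ) ^ (-(s + 1)) * Complex.log t * (-1)))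
    (x₀ := s₀) (bound := bound) hball ?meas ?int ?meas' ?bd ?bdint ?diff
  · exact key
  case meas =>
    exact Eventually.of_forall fun s => (measurable_remainder_mul_cpow hR _).aestronglyMeasurable
  case int => exact integrableOn_remainder hR hRb hs₀
  case meas' =>
    refine Measurable.aestronglyMeasurable ?_
    exact (measurable_ofReal.comp (measurable_remainder hR)).mul
      ((((measurable_ofReal.pow_const _)).mul (measurable_log.comp measurable_ofReal)).mul_const _)
  case bd =>
    rw [ae_restrict_iff' measurableSet_Ioi]
    refine Eventually.of_forall fun t (ht : 1 < t) s hs => ?_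
    have ht0 : 0 < t := zero_lt_one.trans ht
    have hsre := hre s hs
    have hlog : ‖Complex.log t‖ = Real.log t := by
      rw [← ofReal_log ht0.le, Complex.norm_real, Real.norm_eq_abs,
        abs_of_nonneg (Real.log_nonneg ht.le)]
    have hRt : ‖((R t : ℝ) : ℂ)‖ ≤ B₀ * t ^ (1 - κ) := by
      rw [Complex.norm_real, Real.norm_eq_abs]; exact hRb t ht.le
    have hpow : ‖(t : ℂ) ^ (-(s + 1))‖ ≤ t ^ (-(2 - κ + ε / 2)) := by
      rw [norm_cpow_eq_rpow_re_of_pos ht0]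
      refine Real.rpow_le_rpow_of_exponent_le ht.le ?_
      simp only [neg_add_rev, add_re, neg_re, one_re]
      linarith
    have hlogle : Real.log t ≤ t ^ (ε / 4) / (ε / 4) := Real.log_le_rpow_div ht0.le (by positivity)
    rw [norm_mul, norm_mul, norm_mul, hlog, norm_neg, norm_one, mul_one]
    calc ‖((R t : ℝ) : ℂ)‖ * (‖(t : ℂ) ^ (-(s + 1))‖ * Real.log t)
        ≤ (B₀ * t ^ (1 - κ)) * (t ^ (-(2 - κ + ε / 2)) * (t ^ (ε / 4) / (ε / 4))) := by
          gcongr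
          · exact mul_nonneg (norm_nonneg _) (Real.log_nonneg ht.le)
          · exact Real.log_nonneg ht.le
      _ = bound t := by
          simp only [hbound]
          rw [div_eq_mul_inv (t ^ (ε / 4)), show B₀ * t ^ (1 - κ) *
            (t ^ (-(2 - κ + ε / 2)) * (t ^ (ε / 4) * (ε / 4)⁻¹)) =
            B₀ * (ε / 4)⁻¹ * (t ^ (1 - κ) * t ^ (-(2 - κ + ε / 2)) * t ^ (ε / 4)) by ring,
            ← Real.rpow_add ht0, ← Real.rpow_add ht0,
            show 1 - κ + -(2 - κ + ε / 2) + ε / 4 = -(1 + ε / 4) by ring]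
          field_simp
  case bdint =>
    have : IntegrableOn (fun t : ℝ => t ^ (-(1 + ε / 4))) (Ioi 1) :=
      integrableOn_Ioi_rpow_of_lt (by linarith) zero_lt_one
    exact this.const_mul _
  case diff =>
    rw [ae_restrict_iff' measurableSet_Ioi]
    refine Eventually.of_forall fun t (ht : 1 < t) s _ => ?_
    have ht' : (t : ℂ) ≠ 0 := ofReal_ne_zero.mpr (zero_lt_one.trans ht).ne'
    have h1 : HasDerivAt (fun s : ℂ => -(s + 1)) (-1) s :=
      ((hasDerivAt_id s).add_const (1 : ℂ)).neg
    have h2 := (h1.const_cpow (c := (t : ℂ)) (Or.inl ht')).const_mul ((R t : ℝ) : ℂ)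
    simpa using h2

/-- The remainder integral is holomorphic on `Re s > 1 − κ`. [cite: Pintz1977ElementaryVIII, Lemma 2 p. 94] -/
theorem differentiableOn_remainderIntegral (hR : ∀ t, R t = (∑ k ∈ Icc 1 ⌊t⌋₊, f k) - a * t)
    (hRb : ∀ t : ℝ, 1 ≤ t → |R t| ≤ B₀ * t ^ (1 - κ))
    (hI : ∀ s, I s = ∫ t in Ioi (1 : ℝ), ((R t : ℝ) : ℂ) * (t : ℂ) ^ (-(s + 1))) :
    DifferentiableOn ℂ I {s : ℂ | 1 - κ < s.re} := fun _ hs =>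
  (hasDerivAt_remainderIntegral hR hRb hI hs).2.differentiableAt.differentiableWithinAt

/-- The summatory function is `O(n)`: `|∑_{k ≤ n} f(k)| ≤ (|a| + B₀) n` (`κ ≥ 0`). [folklore] -/
private theorem summatory_isBigO (hR : ∀ t, R t = (∑ k ∈ Icc 1 ⌊t⌋₊, f k) - a * t)
    (hRb : ∀ t : ℝ, 1 ≤ t → |R t| ≤ B₀ * t ^ (1 - κ)) (hκ : 0 ≤ κ) :
    (fun n : ℕ => ∑ k ∈ Icc 1 n, f k) =O[atTop] fun n => (n : ℝ) ^ (1 : ℝ) := by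
  have hB₀ := remainderConst_nonneg hRb
  refine IsBigO.of_bound (|a| + B₀) ?_
  filter_upwards [eventually_ge_atTop 1] with n hn
  have hn1 : (1 : ℝ) ≤ n := by exact_mod_cast hn
  have hn0 : (0 : ℝ) < n := by positivity
  have h := hRb n hn1
  rw [hR, Nat.floor_natCast] at h
  rw [Real.norm_eq_abs, Real.norm_eq_abs, Real.rpow_one, abs_of_pos hn0]
  have h1 : (n : ℝ) ^ (1 - κ) ≤ n := by
    conv_rhs => rw [← Real.rpow_one (n : ℝ)]
    exact Real.rpow_le_rpow_of_exponent_le hn1 (by linarith)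
  calc |∑ k ∈ Icc 1 n, f k| = |(∑ k ∈ Icc 1 n, f k - a * n) + a * n| := by ring_nf
    _ ≤ |∑ k ∈ Icc 1 n, f k - a * n| + |a * n| := abs_add_le _ _
    _ ≤ B₀ * (n : ℝ) ^ (1 - κ) + |a| * n := by rw [abs_mul, abs_of_pos hn0]; gcongr
    _ ≤ B₀ * n + |a| * n := by gcongr
    _ = (|a| + B₀) * n := by ring

/-- **Pintz's Lemma 2 on the half-plane of absolute convergence**: for `Re s > 1`,
`∑ f(m) m^{−s} = a s/(s−1) + s ∫_1^∞ R(t) t^{−s−1} dt` (partial summation (3.14), p. 94).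
[cite: Pintz1977ElementaryVIII, Lemma 2 (3.13)–(3.14) pp. 93–94] -/
theorem LSeries_eq_residue_add (hf : ∀ n, 0 ≤ f n)
    (hR : ∀ t, R t = (∑ k ∈ Icc 1 ⌊t⌋₊, f k) - a * t)
    (hRb : ∀ t : ℝ, 1 ≤ t → |R t| ≤ B₀ * t ^ (1 - κ)) (hκ : 0 ≤ κ)
    (hI : ∀ s, I s = ∫ t in Ioi (1 : ℝ), ((R t : ℝ) : ℂ) * (t : ℂ) ^ (-(s + 1)))
    {s : ℂ} (hs : 1 < s.re) :
    LSeries (fun n => (f n : ℂ)) s = a * s / (s - 1) + s * I s := by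
  have hs1 : s - 1 ≠ 0 := by
    intro h; have := congrArg Complex.re h; simp at this; linarith
  have hs1' : (-s + 1) ≠ 0 := by
    intro h; apply hs1; linear_combination -h
  rw [LSeries_eq_mul_integral_of_nonneg f zero_le_one (by simpa using hs)
    (summatory_isBigO hR hRb hκ) hf]
  -- split the summatory function as `a t + R(t)` inside the integral
  have hsplit : EqOn (fun t : ℝ => (∑ k ∈ Icc 1 ⌊t⌋₊, (f k : ℂ)) * (t : ℂ) ^ (-(s + 1)))
      (fun t : ℝ => (a : ℂ) * (t : ℂ) ^ (-s) + ((R t : ℝ) : ℂ) * (t : ℂ) ^ (-(s + 1)))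
      (Ioi 1) := by
    intro t ht
    have ht0 : (t : ℂ) ≠ 0 := ofReal_ne_zero.mpr (zero_lt_one.trans ht).ne'
    have hsum : (∑ k ∈ Icc 1 ⌊t⌋₊, (f k : ℂ)) = ((a * t + R t : ℝ) : ℂ) := by
      rw [hR, ← ofReal_sum]; congr 1; ring
    simp only [hsum]
    have hpow : (t : ℂ) ^ (-s) = (t : ℂ) * (t : ℂ) ^ (-(s + 1)) := by
      rw [show -s = 1 + (-(s + 1)) by ring, cpow_add _ _ ht0, cpow_one]
    rw [hpow]; push_cast; ring
  rw [setIntegral_congr_fun measurableSet_Ioi hsplit]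
  have hint1 : IntegrableOn (fun t : ℝ => (a : ℂ) * (t : ℂ) ^ (-s)) (Ioi 1) :=
    (integrableOn_Ioi_cpow_of_lt (by simpa using hs) zero_lt_one).const_mul _
  have hint2 := integrableOn_remainder hR hRb (s := s) (by linarith)
  rw [integral_add hint1 hint2, integral_const_mul,
    integral_Ioi_cpow_of_lt (by simpa using hs) zero_lt_one, ← hI s]
  rw [ofReal_one, one_cpow]
  field_simp
  ring

/-- The open half-plane `Re s > 1 − κ`. [folklore] -/
private theorem isOpen_halfPlane (c : ℝ) : IsOpen {s : ℂ | c < s.re} :=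
  isOpen_lt continuous_const continuous_re

/-- **Pintz's Lemma 2 — analytic continuation (identity theorem).** If `G` is holomorphic on
`Re s > 1 − κ` and `G(s) = (s − 1) ∑ f(m) m^{−s}` for `Re s > 1`, then on the whole half-plane
`G(s) = a s + s(s−1) ∫_1^∞ R(t) t^{−s−1} dt`; i.e. `F = G/(s−1)` "can be analytically continued in
the half-plane `σ > 1 − 1/(j+1)` except a single pole in `s = 1`".
[cite: Pintz1977ElementaryVIII, Lemma 2 p. 93] -/
theorem continuation_eq (hf : ∀ n, 0 ≤ f n)
    (hR : ∀ t, R t = (∑ k ∈ Icc 1 ⌊t⌋₊, f k) - a * t)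
    (hRb : ∀ t : ℝ, 1 ≤ t → |R t| ≤ B₀ * t ^ (1 - κ)) (hκ : 0 ≤ κ)
    (hI : ∀ s, I s = ∫ t in Ioi (1 : ℝ), ((R t : ℝ) : ℂ) * (t : ℂ) ^ (-(s + 1)))
    {G : ℂ → ℂ} (hG : DifferentiableOn ℂ G {s : ℂ | 1 - κ < s.re})
    (hGL : ∀ s : ℂ, 1 < s.re → G s = (s - 1) * LSeries (fun n => (f n : ℂ)) s)
    {s : ℂ} (hs : 1 - κ < s.re) :
    G s = a * s + s * (s - 1) * I s := by
  set U : Set ℂ := {s : ℂ | 1 - κ < s.re}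
  have hU : IsPreconnected U := (convex_halfSpace_re_gt (1 - κ)).isPreconnected
  have hGan : AnalyticOnNhd ℂ G U := hG.analyticOnNhd (isOpen_halfPlane _)
  have hHan : AnalyticOnNhd ℂ (fun s => a * s + s * (s - 1) * I s) U := by
    refine DifferentiableOn.analyticOnNhd ?_ (isOpen_halfPlane _)
    have hid : DifferentiableOn ℂ (fun s : ℂ => s) U := differentiableOn_id
    exact ((differentiableOn_const _).mul hid).add
      ((hid.mul (hid.sub_const 1)).mul (differentiableOn_remainderIntegral hR hRb hI))
  have h2 : (2 : ℂ) ∈ U := by simp [U]; linarith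
  have hfg : G =ᶠ[𝓝 (2 : ℂ)] fun s => a * s + s * (s - 1) * I s := by
    have hmem : {s : ℂ | 1 < s.re} ∈ 𝓝 (2 : ℂ) := (isOpen_halfPlane 1).mem_nhds (by simp)
    filter_upwards [hmem] with s hs
    have hs1 : s - 1 ≠ 0 := by
      intro h; have := congrArg Complex.re h; simp at this; linarith [show (1:ℝ) < s.re from hs]
    rw [hGL s hs, LSeries_eq_residue_add hf hR hRb hκ hI hs]
    field_simp
  exact hGan.eqOn_of_preconnected_of_eventuallyEq hHan hU h2 hfg hs


/-! ## Part B. Pintz's Lemma 3 on the real axis: the derivative of `a s/(s−1) + s I(s)` at a real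
point `σ`, evaluated by finite Abel summation on `[1, N]` (the printed (3.16)/(4.5)) -/

/-- Real form of the remainder integrand at a real exponent: for `t > 0`,
`R(t) · t^{−(σ+1)}` (complex power) `= R(t) t^{−(σ+1)}` (real power). [folklore] -/
private theorem remainder_mul_cpow_ofReal {t : ℝ} (ht : 0 < t) (σ : ℝ) (x : ℝ) :
    ((x : ℝ) : ℂ) * (t : ℂ) ^ (-((σ : ℂ) + 1)) = ((x * t ^ (-(σ + 1)) : ℝ) : ℂ) := by
  rw [ofReal_mul, Complex.ofReal_cpow ht.le]
  push_cast
  ring_nf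

/-- Real form of the `s`-derivative integrand at a real exponent: for `t > 0`,
`R(t) · (t^{−(σ+1)} · log t · (−1)) = −R(t) t^{−(σ+1)} log t`. [folklore] -/
private theorem remainder_mul_cpow_log_ofReal {t : ℝ} (ht : 0 < t) (σ : ℝ) (x : ℝ) :
    ((x : ℝ) : ℂ) * ((t : ℂ) ^ (-((σ : ℂ) + 1)) * Complex.log t * (-1)) =
      ((-(x * t ^ (-(σ + 1)) * Real.log t) : ℝ) : ℂ) := by
  rw [← Complex.ofReal_log ht.le]
  push_cast
  rw [Complex.ofReal_cpow ht.le]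
  push_cast
  ring_nf

/-- The remainder integral at a real point is the real integral `∫_1^∞ R(t) t^{−σ−1} dt`.
[cite: Pintz1977ElementaryVIII, Lemma 2 (3.12)–(3.15) pp. 93–94] -/
theorem remainderIntegral_ofReal
    (hI : ∀ s, I s = ∫ t in Ioi (1 : ℝ), ((R t : ℝ) : ℂ) * (t : ℂ) ^ (-(s + 1))) (σ : ℝ) :
    I σ = ((∫ t in Ioi (1 : ℝ), R t * t ^ (-(σ + 1)) : ℝ) : ℂ) := by
  rw [hI, ← integral_complex_ofReal]
  refine setIntegral_congr_fun measurableSet_Ioi fun t ht => ?_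
  exact remainder_mul_cpow_ofReal (zero_lt_one.trans ht) σ (R t)

/-- The `s`-derivative of the remainder integral at a real point is `−∫_1^∞ R(t) t^{−σ−1} log t dt`.
[cite: Pintz1977ElementaryVIII, Lemma 3 (3.16) p. 94] -/
theorem remainderIntegral_deriv_ofReal (σ : ℝ) :
    (∫ t in Ioi (1 : ℝ), ((R t : ℝ) : ℂ) * ((t : ℂ) ^ (-((σ : ℂ) + 1)) * Complex.log t * (-1))) =
      ((-(∫ t in Ioi (1 : ℝ), R t * t ^ (-(σ + 1)) * Real.log t) : ℝ) : ℂ) := by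
  rw [← integral_neg, ← integral_complex_ofReal]
  refine setIntegral_congr_fun measurableSet_Ioi fun t ht => ?_
  rw [remainder_mul_cpow_log_ofReal (zero_lt_one.trans ht)]

/-- Integrability of the real integrands `R(t) t^{−σ−1}` and `R(t) t^{−σ−1} log t` on `(1, ∞)`
for `σ > 1 − κ`. [cite: Pintz1977ElementaryVIII, Lemma 2 (3.15) p. 94] -/
theorem integrableOn_remainder_real (hR : ∀ t, R t = (∑ k ∈ Icc 1 ⌊t⌋₊, f k) - a * t)
    (hRb : ∀ t : ℝ, 1 ≤ t → |R t| ≤ B₀ * t ^ (1 - κ))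
    (hI : ∀ s, I s = ∫ t in Ioi (1 : ℝ), ((R t : ℝ) : ℂ) * (t : ℂ) ^ (-(s + 1)))
    {σ : ℝ} (hσ : 1 - κ < σ) :
    IntegrableOn (fun t : ℝ => R t * t ^ (-(σ + 1))) (Ioi 1) ∧
      IntegrableOn (fun t : ℝ => R t * t ^ (-(σ + 1)) * Real.log t) (Ioi 1) := by
  have hσ' : 1 - κ < ((σ : ℂ)).re := by simpa using hσ
  constructor
  · have h := integrableOn_remainder hR hRb hσ'
    have h' : IntegrableOn (fun t : ℝ => (((R t * t ^ (-(σ + 1))) : ℝ) : ℂ)) (Ioi 1) := by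
      refine h.congr_fun (fun t ht => ?_) measurableSet_Ioi
      exact remainder_mul_cpow_ofReal (zero_lt_one.trans ht) σ (R t)
    exact IntegrableOn.congr_fun (Integrable.re h') (fun t _ => by simp) measurableSet_Ioi
  · have h := (hasDerivAt_remainderIntegral hR hRb hI hσ').1
    have h' : IntegrableOn
        (fun t : ℝ => (((-(R t * t ^ (-(σ + 1)) * Real.log t)) : ℝ) : ℂ)) (Ioi 1) := by
      refine h.congr_fun (fun t ht => ?_) measurableSet_Ioi
      exact remainder_mul_cpow_log_ofReal (zero_lt_one.trans ht) σ (R t)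
    have h3 : IntegrableOn (fun t : ℝ => -(R t * t ^ (-(σ + 1)) * Real.log t)) (Ioi 1) := by
      have h2 := Integrable.re h'
      exact IntegrableOn.congr_fun h2 (fun t _ => by simp) measurableSet_Ioi
    refine h3.neg.congr_fun (fun t _ => ?_) measurableSet_Ioi
    simp

/-- **The derivative of `Φ(s) = a s/(s−1) + s I(s)`** (`= ζ(s) F(s)`-type continued Dirichlet
series) at a point `s ≠ 1` of the half-plane `Re s > 1 − κ`:
`Φ′(s) = −a/(s−1)² + I(s) + s I′(s)`. [cite: Pintz1977ElementaryVIII, Lemma 3 p. 94] -/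
theorem hasDerivAt_continuation (hR : ∀ t, R t = (∑ k ∈ Icc 1 ⌊t⌋₊, f k) - a * t)
    (hRb : ∀ t : ℝ, 1 ≤ t → |R t| ≤ B₀ * t ^ (1 - κ))
    (hI : ∀ s, I s = ∫ t in Ioi (1 : ℝ), ((R t : ℝ) : ℂ) * (t : ℂ) ^ (-(s + 1)))
    {s : ℂ} (hs : 1 - κ < s.re) (hs1 : s ≠ 1) :
    HasDerivAt (fun s : ℂ => (a : ℂ) * s / (s - 1) + s * I s)
      (-(a : ℂ) / (s - 1) ^ 2 + (I s + s *
        ∫ t in Ioi (1 : ℝ), ((R t : ℝ) : ℂ) * ((t : ℂ) ^ (-(s + 1)) * Complex.log t * (-1)))) s := by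
  have hs1' : s - 1 ≠ 0 := sub_ne_zero.mpr hs1
  have h1 : HasDerivAt (fun s : ℂ => (a : ℂ) * s / (s - 1)) (-(a : ℂ) / (s - 1) ^ 2) s := by
    have hnum : HasDerivAt (fun s : ℂ => (a : ℂ) * s) (a : ℂ) s := by
      simpa using (hasDerivAt_id s).const_mul (a : ℂ)
    have hden : HasDerivAt (fun s : ℂ => s - 1) 1 s := (hasDerivAt_id s).sub_const 1
    have h := hnum.div hden hs1'
    refine h.congr_deriv ?_
    ring
  have h2 := (hasDerivAt_remainderIntegral hR hRb hI hs).2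
  have h3 : HasDerivAt (fun s : ℂ => s * I s)
      (1 * I s + s * ∫ t in Ioi (1 : ℝ), ((R t : ℝ) : ℂ) *
        ((t : ℂ) ^ (-(s + 1)) * Complex.log t * (-1))) s := (hasDerivAt_id s).mul h2
  rw [one_mul] at h3
  exact h1.add h3

/-- **Real part of `Φ′(σ)` at a real point**:
`Re Φ′(σ) = −a/(1−σ)² + ∫_1^∞ R(t) t^{−σ−1} dt − σ ∫_1^∞ R(t) t^{−σ−1} log t dt`. [cite: Pintz1977ElementaryVIII, Lemma 3 (3.16) p. 94] -/
theorem re_deriv_continuation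
    (hI : ∀ s, I s = ∫ t in Ioi (1 : ℝ), ((R t : ℝ) : ℂ) * (t : ℂ) ^ (-(s + 1))) (a σ : ℝ) :
    (-(a : ℂ) / ((σ : ℂ) - 1) ^ 2 + (I σ + (σ : ℂ) *
        ∫ t in Ioi (1 : ℝ), ((R t : ℝ) : ℂ) * ((t : ℂ) ^ (-((σ : ℂ) + 1)) * Complex.log t * (-1)))).re
      = -a / (1 - σ) ^ 2 + (∫ t in Ioi (1 : ℝ), R t * t ^ (-(σ + 1))) -
          σ * ∫ t in Ioi (1 : ℝ), R t * t ^ (-(σ + 1)) * Real.log t := by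
  rw [remainderIntegral_ofReal hI σ, remainderIntegral_deriv_ofReal σ]
  have h1 : ((σ : ℂ) - 1) ^ 2 = (((σ - 1) ^ 2 : ℝ) : ℂ) := by push_cast; ring
  rw [h1, ← ofReal_neg, ← ofReal_div, ← ofReal_mul, ← ofReal_add, ← ofReal_add, ofReal_re]
  rw [show (σ - 1) ^ 2 = (1 - σ) ^ 2 by ring]
  ring

/-! ### Finite Abel summation on `[1, N]` against the weight `t^{−σ} log t` -/

/-- The weight `g(t) = t^{−σ} log t` has derivative `t^{−σ−1}(1 − σ log t)` at `t > 0`. [folklore] -/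
private theorem hasDerivAt_rpow_mul_log {t : ℝ} (ht : 0 < t) (σ : ℝ) :
    HasDerivAt (fun t : ℝ => t ^ (-σ) * Real.log t)
      (t ^ (-(σ + 1)) * (1 - σ * Real.log t)) t := by
  have h1 : HasDerivAt (fun t : ℝ => t ^ (-σ)) (-σ * t ^ (-σ - 1)) t :=
    Real.hasDerivAt_rpow_const (Or.inl ht.ne')
  have h2 : HasDerivAt Real.log t⁻¹ t := Real.hasDerivAt_log ht.ne'
  have h := h1.mul h2
  refine h.congr_deriv ?_
  have e1 : t ^ (-(σ + 1)) = t ^ (-σ - 1) := by ring_nf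
  have e2 : t ^ (-σ) * t⁻¹ = t ^ (-σ - 1) := by
    rw [Real.rpow_sub ht, Real.rpow_one, div_eq_mul_inv]
  rw [e1, ← e2]
  ring

/-- The primitive `h(t) = t^{1−σ}/(1−σ)² − σ t^{1−σ} log t/(1−σ)` of `t · g′(t) = t^{−σ}(1 − σ log t)`
(`σ ≠ 1`, `t > 0`). [folklore] -/
private theorem hasDerivAt_linearPrimitive {t : ℝ} (ht : 0 < t) {σ : ℝ} (hσ1 : σ ≠ 1) :
    HasDerivAt (fun t : ℝ => t ^ (1 - σ) / (1 - σ) ^ 2 - σ * (t ^ (1 - σ) * Real.log t) / (1 - σ))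
      (t * (t ^ (-(σ + 1)) * (1 - σ * Real.log t))) t := by
  have hσ' : (1 - σ) ≠ 0 := sub_ne_zero.mpr (Ne.symm hσ1)
  have h1 : HasDerivAt (fun t : ℝ => t ^ (1 - σ)) ((1 - σ) * t ^ (1 - σ - 1)) t :=
    Real.hasDerivAt_rpow_const (Or.inl ht.ne')
  have h2 : HasDerivAt Real.log t⁻¹ t := Real.hasDerivAt_log ht.ne'
  have h3 := h1.mul h2
  have h := (h1.div_const ((1 - σ) ^ 2)).sub ((h3.const_mul σ).div_const (1 - σ))
  refine h.congr_deriv ?_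
  have e1 : t ^ (1 - σ - 1) = t ^ (-σ) := by ring_nf
  have e2 : t * (t ^ (-(σ + 1)) * (1 - σ * Real.log t)) = t ^ (-σ) * (1 - σ * Real.log t) := by
    rw [← mul_assoc, show -(σ + 1) = -σ - 1 by ring, Real.rpow_sub ht, Real.rpow_one]
    field_simp
  have e3 : t ^ (1 - σ) * t⁻¹ = t ^ (-σ) := by
    rw [Real.rpow_sub ht, Real.rpow_one, Real.rpow_neg ht.le]
    field_simp
  rw [e1, e2, e3]
  field_simp
  ring

/-- **Abel summation of the summatory function against `g′`** (`g(t) = t^{−σ} log t`, `g(1) = 0`):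
`∫_1^N H(t) g′(t) dt = g(N) H(N) − ∑_{k ≤ N} f(k) g(k)` for a natural number `N ≥ 1`
(`f(0) = 0`). [cite: Pintz1977ElementaryVIII, Lemma 3 p. 94 (footnote (2): "directly from (3.11)
applying the same method as in Lemma 2")] -/
theorem integral_summatory_mul_weightDeriv (hf0 : f 0 = 0) (σ : ℝ) {N : ℕ} (hN : 1 ≤ N) :
    ∫ t in Ioc (1 : ℝ) N, (∑ k ∈ Icc 1 ⌊t⌋₊, f k) * (t ^ (-(σ + 1)) * (1 - σ * Real.log t)) =
      (N : ℝ) ^ (-σ) * Real.log N * (∑ k ∈ Icc 1 N, f k) -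
        ∑ k ∈ Icc 1 N, f k * ((k : ℝ) ^ (-σ) * Real.log k) := by
  have hN1 : (1 : ℝ) ≤ N := by exact_mod_cast hN
  -- the weight and its derivative on `[1, N]`
  have hderiv : ∀ t ∈ Set.Icc (1 : ℝ) N,
      HasDerivAt (fun t : ℝ => t ^ (-σ) * Real.log t) (t ^ (-(σ + 1)) * (1 - σ * Real.log t)) t :=
    fun t ht => hasDerivAt_rpow_mul_log (zero_lt_one.trans_le ht.1) σ
  have hdiff : ∀ t ∈ Set.Icc (1 : ℝ) N, DifferentiableAt ℝ (fun t : ℝ => t ^ (-σ) * Real.log t) t :=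
    fun t ht => (hderiv t ht).differentiableAt
  have hcont : ContinuousOn (fun t : ℝ => t ^ (-(σ + 1)) * (1 - σ * Real.log t)) (Set.Icc (1 : ℝ) N) := by
    refine ContinuousOn.mul ?_ ?_
    · exact ContinuousOn.rpow_const continuousOn_id fun t ht => Or.inl (zero_lt_one.trans_le ht.1).ne'
    · refine continuousOn_const.sub (continuousOn_const.mul ?_)
      exact Real.continuousOn_log.mono fun t ht => (zero_lt_one.trans_le ht.1).ne'
  have hderiv_eq : Set.EqOn (deriv fun t : ℝ => t ^ (-σ) * Real.log t)
      (fun t : ℝ => t ^ (-(σ + 1)) * (1 - σ * Real.log t)) (Set.Icc (1 : ℝ) N) :=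
    fun t ht => (hderiv t ht).deriv
  have hint : IntegrableOn (deriv fun t : ℝ => t ^ (-σ) * Real.log t) (Set.Icc (1 : ℝ) N) :=
    (hcont.integrableOn_Icc).congr_fun hderiv_eq.symm measurableSet_Icc
  have habel := sum_mul_eq_sub_integral_mul₀' (c := f) (f := fun t : ℝ => t ^ (-σ) * Real.log t)
    hf0 N hdiff hint
  -- convert the sums over `Icc 0 _` into sums over `Icc 1 _`
  have hIcc : ∀ (n : ℕ) (g : ℕ → ℝ), ∑ k ∈ Icc 0 n, g k * f k = ∑ k ∈ Icc 1 n, g k * f k := by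
    intro n g
    refine (Finset.sum_subset (fun k hk => ?_) (fun k hk hk' => ?_)).symm
    · simp only [Finset.mem_Icc] at hk ⊢; omega
    · simp only [Finset.mem_Icc, not_and, not_le] at hk hk'
      have : k = 0 := by omega
      rw [this, hf0, mul_zero]
  have hIcc1 : ∀ n : ℕ, ∑ k ∈ Icc 0 n, f k = ∑ k ∈ Icc 1 n, f k := by
    intro n
    have := hIcc n (fun _ => 1)
    simpa using this
  rw [hIcc, hIcc1] at habel
  simp_rw [hIcc1] at habel
  -- replace `deriv g` by the explicit derivative inside the integral over `Ioc 1 N`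
  have hint_eq : ∫ t in Ioc (1 : ℝ) N, deriv (fun t : ℝ => t ^ (-σ) * Real.log t) t *
      ∑ k ∈ Icc 1 ⌊t⌋₊, f k =
      ∫ t in Ioc (1 : ℝ) N, (∑ k ∈ Icc 1 ⌊t⌋₊, f k) * (t ^ (-(σ + 1)) * (1 - σ * Real.log t)) := by
    refine setIntegral_congr_fun measurableSet_Ioc fun t ht => ?_
    rw [hderiv_eq ⟨ht.1.le, ht.2⟩, mul_comm]
  rw [← hint_eq]
  have e : ∑ k ∈ Icc 1 N, f k * ((k : ℝ) ^ (-σ) * Real.log k) =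
      ∑ k ∈ Icc 1 N, ((k : ℝ) ^ (-σ) * Real.log k) * f k := by
    refine Finset.sum_congr rfl fun k _ => by ring
  rw [e, habel]
  ring

/-- `∫_1^N a t · g′(t) dt = a (h(N) − h(1))` with `h` the primitive of `t g′(t)`, `h(1) = 1/(1−σ)²`.
[folklore] -/
private theorem integral_linear_mul_weightDeriv (a : ℝ) {σ : ℝ} (hσ1 : σ ≠ 1) {N : ℕ} (hN : 1 ≤ N) :
    ∫ t in Ioc (1 : ℝ) N, a * t * (t ^ (-(σ + 1)) * (1 - σ * Real.log t)) =
      a * (((N : ℝ) ^ (1 - σ) / (1 - σ) ^ 2 - σ * ((N : ℝ) ^ (1 - σ) * Real.log N) / (1 - σ))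
        - 1 / (1 - σ) ^ 2) := by
  have hN1 : (1 : ℝ) ≤ N := by exact_mod_cast hN
  have hderiv : ∀ t ∈ Set.uIcc (1 : ℝ) N, HasDerivAt
      (fun t : ℝ => a * (t ^ (1 - σ) / (1 - σ) ^ 2 - σ * (t ^ (1 - σ) * Real.log t) / (1 - σ)))
      (a * t * (t ^ (-(σ + 1)) * (1 - σ * Real.log t))) t := by
    intro t ht
    rw [Set.uIcc_of_le hN1] at ht
    have h := (hasDerivAt_linearPrimitive (zero_lt_one.trans_le ht.1) hσ1).const_mul a
    refine h.congr_deriv ?_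
    ring
  have hcont : ContinuousOn (fun t : ℝ => a * t * (t ^ (-(σ + 1)) * (1 - σ * Real.log t)))
      (Set.uIcc (1 : ℝ) N) := by
    rw [Set.uIcc_of_le hN1]
    refine (continuousOn_const.mul continuousOn_id).mul (ContinuousOn.mul ?_ ?_)
    · exact ContinuousOn.rpow_const continuousOn_id fun t ht => Or.inl (zero_lt_one.trans_le ht.1).ne'
    · refine continuousOn_const.sub (continuousOn_const.mul ?_)
      exact Real.continuousOn_log.mono fun t ht => (zero_lt_one.trans_le ht.1).ne'
  have hFTC := intervalIntegral.integral_eq_sub_of_hasDerivAt hderiv hcont.intervalIntegrable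
  rw [intervalIntegral.integral_of_le hN1] at hFTC
  rw [hFTC]
  simp only [Real.one_rpow, Real.log_one, mul_zero, zero_div, sub_zero, one_div]
  ring

/-- **The `[1, N]` part of `∫ R g′`**:
`∫_1^N R(t) t^{−σ−1}(1 − σ log t) dt = N^{−σ} log N · H(N) − ∑_{k≤N} f(k) k^{−σ} log k − a (h(N) − h(1))`.
[cite: Pintz1977ElementaryVIII, Lemma 3 (3.16) p. 94] -/
theorem integral_Ioc_remainder_mul_weightDeriv (hf0 : f 0 = 0)
    (hR : ∀ t, R t = (∑ k ∈ Icc 1 ⌊t⌋₊, f k) - a * t) {σ : ℝ} (hσ1 : σ ≠ 1) {N : ℕ} (hN : 1 ≤ N) :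
    ∫ t in Ioc (1 : ℝ) N, R t * (t ^ (-(σ + 1)) * (1 - σ * Real.log t)) =
      ((N : ℝ) ^ (-σ) * Real.log N * (∑ k ∈ Icc 1 N, f k) -
        ∑ k ∈ Icc 1 N, f k * ((k : ℝ) ^ (-σ) * Real.log k)) -
      a * (((N : ℝ) ^ (1 - σ) / (1 - σ) ^ 2 - σ * ((N : ℝ) ^ (1 - σ) * Real.log N) / (1 - σ))
        - 1 / (1 - σ) ^ 2) := by
  have hN1 : (1 : ℝ) ≤ N := by exact_mod_cast hN
  rw [← integral_summatory_mul_weightDeriv hf0 σ hN, ← integral_linear_mul_weightDeriv a hσ1 hN,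
    ← integral_sub]
  · refine setIntegral_congr_fun measurableSet_Ioc fun t _ => ?_
    rw [hR]; ring
  · -- integrability of the summatory part: bounded measurable on a finite interval
    have hcont : ContinuousOn (fun t : ℝ => t ^ (-(σ + 1)) * (1 - σ * Real.log t)) (Set.Icc (1 : ℝ) N) := by
      refine ContinuousOn.mul ?_ ?_
      · exact ContinuousOn.rpow_const continuousOn_id fun t ht => Or.inl (zero_lt_one.trans_le ht.1).ne'
      · refine continuousOn_const.sub (continuousOn_const.mul ?_)
        exact Real.continuousOn_log.mono fun t ht => (zero_lt_one.trans_le ht.1).ne'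
    have hg : IntegrableOn (fun t : ℝ => t ^ (-(σ + 1)) * (1 - σ * Real.log t)) (Set.Ioc (1 : ℝ) N) :=
      hcont.integrableOn_Icc.mono_set Set.Ioc_subset_Icc_self
    -- the summatory function is bounded on `Ioc 1 N` by `∑_{k ≤ N} |f k|`
    refine Integrable.mono' (hg.norm.const_mul (∑ k ∈ Icc 1 N, |f k|)) ?_ ?_
    · exact (measurable_summatory f).aestronglyMeasurable.mul hg.aestronglyMeasurable
    · rw [ae_restrict_iff' measurableSet_Ioc]
      refine Eventually.of_forall fun t ht => ?_
      rw [norm_mul]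
      refine mul_le_mul_of_nonneg_right ?_ (norm_nonneg _)
      have hfl : ⌊t⌋₊ ≤ N := by
        refine Nat.floor_le_of_le ?_
        exact ht.2
      rw [Real.norm_eq_abs]
      calc |∑ k ∈ Icc 1 ⌊t⌋₊, f k| ≤ ∑ k ∈ Icc 1 ⌊t⌋₊, |f k| := Finset.abs_sum_le_sum_abs _ _
        _ ≤ ∑ k ∈ Icc 1 N, |f k| := by
            refine Finset.sum_le_sum_of_subset_of_nonneg ?_ fun _ _ _ => abs_nonneg _
            exact Finset.Icc_subset_Icc_right hfl
  · have hcont : ContinuousOn (fun t : ℝ => a * t * (t ^ (-(σ + 1)) * (1 - σ * Real.log t)))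
        (Set.Icc (1 : ℝ) N) := by
      refine (continuousOn_const.mul continuousOn_id).mul (ContinuousOn.mul ?_ ?_)
      · exact ContinuousOn.rpow_const continuousOn_id fun t ht => Or.inl (zero_lt_one.trans_le ht.1).ne'
      · refine continuousOn_const.sub (continuousOn_const.mul ?_)
        exact Real.continuousOn_log.mono fun t ht => (zero_lt_one.trans_le ht.1).ne'
    exact hcont.integrableOn_Icc.mono_set Set.Ioc_subset_Icc_self

/-! ### Splitting the remainder integral at `N` and the formula for `Re Φ′(σ)` -/

/-- **Pintz's (4.5) in exact form.** For `1 − κ < σ < 1` and a natural number `N ≥ 1`: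
`Re Φ′(σ) = −∑_{k≤N} f(k) k^{−σ} log k − a N^{1−σ}(1/(1−σ)² − log N/(1−σ)) + R(N) N^{−σ} log N
 + ∫_N^∞ R(t) t^{−σ−1}(1 − σ log t) dt`. [cite: Pintz1977ElementaryVIII, Lemma 3 (3.16) p. 94 and (4.5) p. 96] -/
theorem re_deriv_eq (hf0 : f 0 = 0) (hR : ∀ t, R t = (∑ k ∈ Icc 1 ⌊t⌋₊, f k) - a * t)
    (hRb : ∀ t : ℝ, 1 ≤ t → |R t| ≤ B₀ * t ^ (1 - κ))
    (hI : ∀ s, I s = ∫ t in Ioi (1 : ℝ), ((R t : ℝ) : ℂ) * (t : ℂ) ^ (-(s + 1)))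
    {σ : ℝ} (hσ : 1 - κ < σ) (hσ1 : σ < 1) {N : ℕ} (hN : 1 ≤ N) :
    (-(a : ℂ) / ((σ : ℂ) - 1) ^ 2 + (I σ + (σ : ℂ) *
        ∫ t in Ioi (1 : ℝ), ((R t : ℝ) : ℂ) * ((t : ℂ) ^ (-((σ : ℂ) + 1)) * Complex.log t * (-1)))).re
      = -(∑ k ∈ Icc 1 N, f k * ((k : ℝ) ^ (-σ) * Real.log k))
        - a * ((N : ℝ) ^ (1 - σ) * (1 / (1 - σ) ^ 2 - Real.log N / (1 - σ)))
        + R N * ((N : ℝ) ^ (-σ) * Real.log N)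
        + ∫ t in Ioi (N : ℝ), R t * (t ^ (-(σ + 1)) * (1 - σ * Real.log t)) := by
  have hN1 : (1 : ℝ) ≤ N := by exact_mod_cast hN
  have hN0 : (0 : ℝ) < N := by positivity
  have hσ1' : σ ≠ 1 := hσ1.ne
  have h1σ : (1 - σ) ≠ 0 := sub_ne_zero.mpr (Ne.symm hσ1')
  rw [re_deriv_continuation hI a σ]
  obtain ⟨hJ0, hJ1⟩ := integrableOn_remainder_real hR hRb hI hσ
  have hint : IntegrableOn (fun t : ℝ => R t * (t ^ (-(σ + 1)) * (1 - σ * Real.log t))) (Ioi 1) := by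
    have := hJ0.sub (hJ1.const_mul σ)
    exact this.congr_fun (fun t _ => by simp only [Pi.sub_apply]; ring) measurableSet_Ioi
  have hcomb : (∫ t in Ioi (1 : ℝ), R t * t ^ (-(σ + 1))) -
      σ * ∫ t in Ioi (1 : ℝ), R t * t ^ (-(σ + 1)) * Real.log t =
      ∫ t in Ioi (1 : ℝ), R t * (t ^ (-(σ + 1)) * (1 - σ * Real.log t)) := by
    rw [← integral_const_mul, ← integral_sub hJ0 (hJ1.const_mul σ)]
    refine setIntegral_congr_fun measurableSet_Ioi fun t _ => ?_
    ring
  have hsplit : ∫ t in Ioi (1 : ℝ), R t * (t ^ (-(σ + 1)) * (1 - σ * Real.log t)) =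
      (∫ t in Ioc (1 : ℝ) N, R t * (t ^ (-(σ + 1)) * (1 - σ * Real.log t))) +
        ∫ t in Ioi (N : ℝ), R t * (t ^ (-(σ + 1)) * (1 - σ * Real.log t)) := by
    rw [← setIntegral_union (Set.Ioc_disjoint_Ioi le_rfl) measurableSet_Ioi
      (hint.mono_set Set.Ioc_subset_Ioi_self) (hint.mono_set (Set.Ioi_subset_Ioi hN1)),
      Set.Ioc_union_Ioi_eq_Ioi hN1]
  have hRN : R N = (∑ k ∈ Icc 1 N, f k) - a * N := by rw [hR, Nat.floor_natCast]
  rw [add_sub_assoc, hcomb, hsplit, integral_Ioc_remainder_mul_weightDeriv hf0 hR hσ1' hN]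
  have hsum : ∑ k ∈ Icc 1 N, f k = a * N + R N := by rw [hRN]; ring
  rw [hsum]
  have e1 : (N : ℝ) ^ (1 - σ) = (N : ℝ) * (N : ℝ) ^ (-σ) := by
    rw [show (1 - σ) = 1 + (-σ) by ring, Real.rpow_add hN0, Real.rpow_one]
  rw [e1]
  field_simp
  ring

/-! ### The tail integrals `∫_N^∞ t^{−α−1} dt`, `∫_N^∞ t^{−α−1} log t dt` -/

/-- `∫_N^∞ t^{−α−1} dt = N^{−α}/α` (`α > 0`, `N > 0`). [folklore] -/
private theorem integral_Ioi_rpow_neg {α : ℝ} (hα : 0 < α) {c : ℝ} (hc : 0 < c) :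
    ∫ t in Ioi c, t ^ (-(α + 1)) = c ^ (-α) / α := by
  rw [integral_Ioi_rpow_of_lt (by linarith) hc, show -(α + 1) + 1 = -α by ring]
  field_simp

/-- `t^{−α} log t → 0` at `+∞` (`α > 0`). [folklore] -/
private theorem tendsto_rpow_neg_mul_log {α : ℝ} (hα : 0 < α) :
    Tendsto (fun t : ℝ => t ^ (-α) * Real.log t) atTop (𝓝 0) := by
  have h := (isLittleO_log_rpow_atTop hα).tendsto_div_nhds_zero
  refine h.congr' ?_
  filter_upwards [eventually_gt_atTop 0] with t ht
  rw [Real.rpow_neg ht.le, div_eq_mul_inv, mul_comm]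

/-- The primitive of `t^{−α−1} log t`: `d/dt [−t^{−α}(log t/α + 1/α²)] = t^{−α−1} log t`
(`t > 0`, `α ≠ 0`). [folklore] -/
private theorem hasDerivAt_rpow_neg_log_primitive {α : ℝ} (hα : α ≠ 0) {t : ℝ} (ht : 0 < t) :
    HasDerivAt (fun t : ℝ => -(t ^ (-α) * (Real.log t / α + 1 / α ^ 2)))
      (t ^ (-(α + 1)) * Real.log t) t := by
  have h1 : HasDerivAt (fun t : ℝ => t ^ (-α)) (-α * t ^ (-α - 1)) t :=
    Real.hasDerivAt_rpow_const (Or.inl ht.ne')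
  have h2 : HasDerivAt (fun t : ℝ => Real.log t / α + 1 / α ^ 2) (t⁻¹ / α) t := by
    simpa using ((Real.hasDerivAt_log ht.ne').div_const α).add_const (1 / α ^ 2)
  have h := (h1.mul h2).neg
  refine h.congr_deriv ?_
  have e1 : t ^ (-(α + 1)) = t ^ (-α - 1) := by ring_nf
  have e2 : t ^ (-α) * t⁻¹ = t ^ (-α - 1) := by
    rw [Real.rpow_sub ht, Real.rpow_one, div_eq_mul_inv]
  rw [e1, ← e2]
  field_simp
  ring

/-- `∫_N^∞ t^{−α−1} log t dt = N^{−α}(log N/α + 1/α²)` for `N ≥ 1`, `α > 0`, together with the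
integrability of the integrand. [folklore] -/
private theorem integral_Ioi_rpow_neg_mul_log {α : ℝ} (hα : 0 < α) {c : ℝ} (hc : 1 ≤ c) :
    IntegrableOn (fun t : ℝ => t ^ (-(α + 1)) * Real.log t) (Ioi c) ∧
      ∫ t in Ioi c, t ^ (-(α + 1)) * Real.log t = c ^ (-α) * (Real.log c / α + 1 / α ^ 2) := by
  have hc0 : 0 < c := zero_lt_one.trans_le hc
  have hcont : ContinuousWithinAt (fun t : ℝ => -(t ^ (-α) * (Real.log t / α + 1 / α ^ 2)))
      (Set.Ici c) c :=
    (hasDerivAt_rpow_neg_log_primitive hα.ne' hc0).continuousAt.continuousWithinAt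
  have hderiv : ∀ t ∈ Set.Ioi c, HasDerivAt (fun t : ℝ => -(t ^ (-α) * (Real.log t / α + 1 / α ^ 2)))
      (t ^ (-(α + 1)) * Real.log t) t :=
    fun t ht => hasDerivAt_rpow_neg_log_primitive hα.ne' (hc0.trans ht)
  have hpos : ∀ t ∈ Set.Ioi c, 0 ≤ t ^ (-(α + 1)) * Real.log t := fun t ht =>
    mul_nonneg (Real.rpow_nonneg (hc0.trans ht).le _) (Real.log_nonneg (hc.trans (le_of_lt ht)))
  have hlim : Tendsto (fun t : ℝ => -(t ^ (-α) * (Real.log t / α + 1 / α ^ 2))) atTop (𝓝 0) := by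
    have h1 := tendsto_rpow_neg_mul_log hα
    have h2 := tendsto_rpow_neg_atTop hα
    have h3 : Tendsto (fun t : ℝ => -((t ^ (-α) * Real.log t) / α + t ^ (-α) * (1 / α ^ 2)))
        atTop (𝓝 (-((0 : ℝ) / α + 0 * (1 / α ^ 2)))) :=
      ((h1.div_const α).add (h2.mul_const _)).neg
    simp only [zero_div, zero_mul, add_zero, neg_zero] at h3
    refine h3.congr' (Eventually.of_forall fun t => ?_)
    ring
  refine ⟨integrableOn_Ioi_deriv_of_nonneg hcont hderiv hpos hlim, ?_⟩
  rw [integral_Ioi_of_hasDerivAt_of_nonneg hcont hderiv hpos hlim]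
  ring

/-- **The tail bound**: if `|R(t)| ≤ B t^{1−κ}` for `t ≥ N` (`N ≥ 1`), then for `0 ≤ σ`,
`α = σ + κ − 1 > 0`,
`|∫_N^∞ R(t) t^{−σ−1}(1 − σ log t) dt| ≤ B N^{−α}(1/α + σ(log N/α + 1/α²))`.
[cite: Pintz1977ElementaryVIII, Lemma 2 (3.15) p. 94] -/
theorem abs_tail_le {B : ℝ} {N : ℕ} (hN : 1 ≤ N) (hB : ∀ t : ℝ, (N : ℝ) ≤ t → |R t| ≤ B * t ^ (1 - κ))
    {σ : ℝ} (hσ0 : 0 ≤ σ) (hα : 0 < σ + κ - 1) :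
    |∫ t in Ioi (N : ℝ), R t * (t ^ (-(σ + 1)) * (1 - σ * Real.log t))| ≤
      B * (N : ℝ) ^ (-(σ + κ - 1)) *
        (1 / (σ + κ - 1) + σ * (Real.log N / (σ + κ - 1) + 1 / (σ + κ - 1) ^ 2)) := by
  set α := σ + κ - 1 with hαdef
  have hN1 : (1 : ℝ) ≤ N := by exact_mod_cast hN
  have hN0 : (0 : ℝ) < N := by positivity
  obtain ⟨hlogint, hlogval⟩ := integral_Ioi_rpow_neg_mul_log hα hN1
  have hpowint : IntegrableOn (fun t : ℝ => t ^ (-(α + 1))) (Ioi (N : ℝ)) :=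
    integrableOn_Ioi_rpow_of_lt (by linarith) hN0
  have hg : IntegrableOn (fun t : ℝ => B * t ^ (-(α + 1)) + B * σ * (t ^ (-(α + 1)) * Real.log t))
      (Ioi (N : ℝ)) := (hpowint.const_mul B).add (hlogint.const_mul (B * σ))
  have hbound : ∀ᵐ t ∂(volume.restrict (Ioi (N : ℝ))),
      ‖R t * (t ^ (-(σ + 1)) * (1 - σ * Real.log t))‖ ≤
        B * t ^ (-(α + 1)) + B * σ * (t ^ (-(α + 1)) * Real.log t) := by
    rw [ae_restrict_iff' measurableSet_Ioi]
    refine Eventually.of_forall fun t (ht : (N : ℝ) < t) => ?_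
    have ht0 : 0 < t := hN0.trans ht
    have ht1 : 1 ≤ t := hN1.trans ht.le
    have hlog : 0 ≤ Real.log t := Real.log_nonneg ht1
    have hRt := hB t ht.le
    have hpow : t ^ (1 - κ) * t ^ (-(σ + 1)) = t ^ (-(α + 1)) := by
      rw [← Real.rpow_add ht0]; congr 1; rw [hαdef]; ring
    rw [Real.norm_eq_abs, abs_mul, abs_mul, abs_of_nonneg (Real.rpow_nonneg ht0.le _)]
    have h1 : |1 - σ * Real.log t| ≤ 1 + σ * Real.log t := by
      rw [abs_le]; constructor <;> nlinarith [mul_nonneg hσ0 hlog]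
    have hfac : 0 ≤ t ^ (-(σ + 1)) * (1 + σ * Real.log t) :=
      mul_nonneg (Real.rpow_nonneg ht0.le _) (by nlinarith [mul_nonneg hσ0 hlog])
    calc |R t| * (t ^ (-(σ + 1)) * |1 - σ * Real.log t|)
        ≤ |R t| * (t ^ (-(σ + 1)) * (1 + σ * Real.log t)) :=
          mul_le_mul_of_nonneg_left (mul_le_mul_of_nonneg_left h1 (Real.rpow_nonneg ht0.le _))
            (abs_nonneg _)
      _ ≤ (B * t ^ (1 - κ)) * (t ^ (-(σ + 1)) * (1 + σ * Real.log t)) :=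
          mul_le_mul_of_nonneg_right hRt hfac
      _ = B * t ^ (-(α + 1)) + B * σ * (t ^ (-(α + 1)) * Real.log t) := by
          rw [← hpow]; ring
  have h := norm_integral_le_of_norm_le hg hbound
  rw [Real.norm_eq_abs] at h
  refine h.trans (le_of_eq ?_)
  rw [integral_add (hpowint.const_mul B) (hlogint.const_mul (B * σ)), integral_const_mul,
    integral_const_mul, integral_Ioi_rpow_neg hα hN0, hlogval]
  ring

/-! ### The inequality `Re Φ′(σ) ≤ −log 4/4 + E(N, σ)` (Pintz's (4.5)) -/

/-- **Pintz's (4.5), quantitative.** Let `f ≥ 0` with `f(0) = 0`, `f(4) ≥ 1`, `a ≥ 0`; let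
`|R(t)| ≤ B₀ t^{1−κ}` for `t ≥ 1` and `|R(t)| ≤ B t^{1−κ}` for `t ≥ N` (`N ≥ 4`). Then for
`max(1 − κ, 0, 1 − 1/log N) ≤ σ < 1` (with `σ > 1 − κ`) and `α = σ + κ − 1`:
`Re Φ′(σ) ≤ −(log 4)/4 + B N^{−α}(log N + 1/α + σ(log N/α + 1/α²))`.
[cite: Pintz1977ElementaryVIII, (4.5) p. 96] -/
theorem re_deriv_le (hf : ∀ n, 0 ≤ f n) (hf0 : f 0 = 0) (hf4 : 1 ≤ f 4) (ha : 0 ≤ a)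
    (hR : ∀ t, R t = (∑ k ∈ Icc 1 ⌊t⌋₊, f k) - a * t)
    (hRb : ∀ t : ℝ, 1 ≤ t → |R t| ≤ B₀ * t ^ (1 - κ))
    (hI : ∀ s, I s = ∫ t in Ioi (1 : ℝ), ((R t : ℝ) : ℂ) * (t : ℂ) ^ (-(s + 1)))
    {B : ℝ} {N : ℕ} (hN : 4 ≤ N) (hB : ∀ t : ℝ, (N : ℝ) ≤ t → |R t| ≤ B * t ^ (1 - κ))
    {σ : ℝ} (hσκ : 1 - κ < σ) (hσ0 : 0 ≤ σ) (hσ1 : σ < 1) (hσN : 1 - 1 / Real.log N ≤ σ) :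
    (-(a : ℂ) / ((σ : ℂ) - 1) ^ 2 + (I σ + (σ : ℂ) *
        ∫ t in Ioi (1 : ℝ), ((R t : ℝ) : ℂ) * ((t : ℂ) ^ (-((σ : ℂ) + 1)) * Complex.log t * (-1)))).re
      ≤ -(Real.log 4) / 4 + B * (N : ℝ) ^ (-(σ + κ - 1)) *
          (Real.log N + 1 / (σ + κ - 1) + σ * (Real.log N / (σ + κ - 1) + 1 / (σ + κ - 1) ^ 2)) := by
  have hN1 : 1 ≤ N := le_trans (by norm_num) hN
  have hN1' : (1 : ℝ) ≤ N := by exact_mod_cast hN1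
  have hN4 : (4 : ℝ) ≤ N := by exact_mod_cast hN
  have hN0 : (0 : ℝ) < N := by positivity
  have hα : 0 < σ + κ - 1 := by linarith
  have hlog4 : 0 < Real.log 4 := Real.log_pos (by norm_num)
  have hlogN : Real.log 4 ≤ Real.log N := Real.log_le_log (by norm_num) hN4
  have hlogN1 : 1 < Real.log N := by
    have : (1 : ℝ) < Real.log 4 := by
      rw [show (4 : ℝ) = 2 ^ 2 by norm_num, Real.log_pow]
      have := Real.log_two_gt_d9; norm_num at this ⊢; linarith
    linarith
  have hlogNpos : 0 < Real.log N := by linarith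
  rw [re_deriv_eq hf0 hR hRb hI hσκ hσ1 hN1]
  -- term 1: the sum dominates its `k = 4` term
  have h1 : Real.log 4 / 4 ≤ ∑ k ∈ Icc 1 N, f k * ((k : ℝ) ^ (-σ) * Real.log k) := by
    have h4mem : (4 : ℕ) ∈ Finset.Icc 1 N := by rw [Finset.mem_Icc]; omega
    have hterm : Real.log 4 / 4 ≤ f 4 * (((4 : ℕ) : ℝ) ^ (-σ) * Real.log (4 : ℕ)) := by
      have hp : (1 : ℝ) / 4 ≤ ((4 : ℕ) : ℝ) ^ (-σ) := by
        rw [show ((4 : ℕ) : ℝ) = 4 by norm_num, show (1 : ℝ) / 4 = (4 : ℝ) ^ (-(1 : ℝ)) by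
          rw [Real.rpow_neg (by norm_num), Real.rpow_one]; norm_num]
        exact Real.rpow_le_rpow_of_exponent_le (by norm_num) (by linarith)
      have : Real.log 4 / 4 = 1 * ((1 / 4) * Real.log 4) := by ring
      rw [this, show ((4 : ℕ) : ℝ) = (4 : ℝ) by norm_num] at *
      gcongr
    refine hterm.trans ?_
    refine Finset.single_le_sum (f := fun k => f k * ((k : ℝ) ^ (-σ) * Real.log k)) ?_ h4mem
    intro k hk
    have hk1 : (1 : ℝ) ≤ k := by exact_mod_cast (Finset.mem_Icc.mp hk).1
    exact mul_nonneg (hf k) (mul_nonneg (Real.rpow_nonneg (by linarith) _) (Real.log_nonneg hk1))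
  -- term 2: non-positive on the window
  have h2 : 0 ≤ a * ((N : ℝ) ^ (1 - σ) * (1 / (1 - σ) ^ 2 - Real.log N / (1 - σ))) := by
    have h1σ : 0 < 1 - σ := by linarith
    have hw : (1 - σ) * Real.log N ≤ 1 := by
      have : 1 - σ ≤ 1 / Real.log N := by linarith
      calc (1 - σ) * Real.log N ≤ (1 / Real.log N) * Real.log N :=
            mul_le_mul_of_nonneg_right this hlogNpos.le
        _ = 1 := by field_simp
    have hbr : 0 ≤ 1 / (1 - σ) ^ 2 - Real.log N / (1 - σ) := by
      rw [div_sub_div _ _ (by positivity) h1σ.ne', le_div_iff₀ (by positivity)]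
      nlinarith
    exact mul_nonneg ha (mul_nonneg (Real.rpow_nonneg hN0.le _) hbr)
  -- term 3
  have h3 : R N * ((N : ℝ) ^ (-σ) * Real.log N) ≤ B * (N : ℝ) ^ (-(σ + κ - 1)) * Real.log N := by
    have hRN := hB N le_rfl
    have hpow : (N : ℝ) ^ (1 - κ) * (N : ℝ) ^ (-σ) = (N : ℝ) ^ (-(σ + κ - 1)) := by
      rw [← Real.rpow_add hN0]; ring_nf
    calc R N * ((N : ℝ) ^ (-σ) * Real.log N) ≤ |R N| * ((N : ℝ) ^ (-σ) * Real.log N) :=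
          mul_le_mul_of_nonneg_right (le_abs_self _)
            (mul_nonneg (Real.rpow_nonneg hN0.le _) hlogNpos.le)
      _ ≤ (B * (N : ℝ) ^ (1 - κ)) * ((N : ℝ) ^ (-σ) * Real.log N) :=
          mul_le_mul_of_nonneg_right hRN (mul_nonneg (Real.rpow_nonneg hN0.le _) hlogNpos.le)
      _ = B * (N : ℝ) ^ (-(σ + κ - 1)) * Real.log N := by rw [← hpow]; ring
  -- term 4
  have h4 := (abs_le.mp (abs_tail_le (R := R) hN1 hB hσ0 hα)).2
  nlinarith [h1, h2, h3, h4]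

/-! ### Rolle: a negative real part of the derivative allows at most one real zero -/

/-- **At most one real zero.** If `F` is differentiable at every point of `[lo, hi]` with
`Re F′(σ) < 0` there, then `F` has at most one zero in `[lo, hi]` (Rolle's theorem for
`σ ↦ Re F(σ)`). [cite: Pintz1977ElementaryVIII, proof of Theorems 4–5 p. 96] -/
theorem eq_of_zeros_of_re_deriv_neg {F F' : ℂ → ℂ} {lo hi : ℝ}
    (hd : ∀ σ : ℝ, σ ∈ Set.Icc lo hi → HasDerivAt F (F' σ) σ)
    (hneg : ∀ σ : ℝ, σ ∈ Set.Icc lo hi → (F' σ).re < 0)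
    {β₁ β₂ : ℝ} (h₁ : β₁ ∈ Set.Icc lo hi) (h₂ : β₂ ∈ Set.Icc lo hi)
    (hz₁ : F β₁ = 0) (hz₂ : F β₂ = 0) : β₁ = β₂ := by
  by_contra hne
  -- the real function `u(x) = Re F(x)` and its derivative
  have hu : ∀ x : ℝ, x ∈ Set.Icc lo hi →
      HasDerivAt (fun y : ℝ => (F y).re) ((F' x).re) x := by
    intro x hx
    have h := (hd x hx).comp_ofReal
    have h2 := (Complex.reCLM.hasFDerivAt.comp_hasDerivAt x h)
    exact h2
  have key : ∀ b₁ b₂ : ℝ, b₁ ∈ Set.Icc lo hi → b₂ ∈ Set.Icc lo hi → b₁ < b₂ →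
      F b₁ = 0 → F b₂ = 0 → False := by
    intro b₁ b₂ hb₁ hb₂ hlt hz1 hz2
    have hsub : Set.Icc b₁ b₂ ⊆ Set.Icc lo hi := Set.Icc_subset_Icc hb₁.1 hb₂.2
    have hcont : ContinuousOn (fun y : ℝ => (F y).re) (Set.Icc b₁ b₂) := fun x hx =>
      (hu x (hsub hx)).continuousAt.continuousWithinAt
    have hends : (fun y : ℝ => (F y).re) b₁ = (fun y : ℝ => (F y).re) b₂ := by
      simp [hz1, hz2]
    obtain ⟨c, hc, hc0⟩ := exists_hasDerivAt_eq_zero hlt hcont hends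
      (fun x hx => hu x (hsub (Set.Ioo_subset_Icc_self hx)))
    have := hneg c (hsub (Set.Ioo_subset_Icc_self hc))
    linarith
  rcases lt_or_gt_of_ne hne with hlt | hlt
  · exact key β₁ β₂ h₁ h₂ hlt hz₁ hz₂
  · exact key β₂ β₁ h₂ h₁ hlt hz₂ hz₁
end Engine


/-! ## Part C. Pintz's Lemma 1 for `j = 1` at Pólya–Vinogradov strength:
`∑_{n ≤ t} (1 ∗ χ)(n) = L(1, χ) t + O(√(A t))` when `|∑_{n ≤ M} χ(n)| ≤ A` -/

section HyperbolaPV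

open DirichletAbel RealChar

variable {q : ℕ} [NeZero q] (χ : DirichletCharacter ℂ q)

omit [NeZero q] in
/-- Interval character sums from a partial-sum bound: `|∑_{y < a ≤ M} χ(a)| ≤ 2A`. [folklore] -/
private theorem abs_sum_Ioc_reChar_le_of_partialSum_le {A : ℝ} (hA : ∀ n, ‖partialSum χ n‖ ≤ A)
    (y M : ℕ) : |∑ a ∈ Ioc y M, reChar χ a| ≤ 2 * A := by
  have hA0 : 0 ≤ A := (norm_nonneg _).trans (hA 0)
  rcases le_or_gt M y with h | h
  · rw [Finset.Ioc_eq_empty (not_lt.mpr h), sum_empty, abs_zero]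
    linarith
  · have hsplit := sum_Ioc_consecutive (fun a => reChar χ a) (Nat.zero_le y) h.le
    have heq : ∑ a ∈ Ioc y M, reChar χ a =
        ∑ a ∈ Ioc 0 M, reChar χ a - ∑ a ∈ Ioc 0 y, reChar χ a := by linarith
    rw [heq, sum_Ioc_reChar_eq, sum_Ioc_reChar_eq]
    calc |(partialSum χ M).re - (partialSum χ y).re|
        ≤ |(partialSum χ M).re| + |(partialSum χ y).re| := abs_sub _ _
      _ ≤ ‖partialSum χ M‖ + ‖partialSum χ y‖ := add_le_add (abs_re_le_norm _) (abs_re_le_norm _)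
      _ ≤ A + A := add_le_add (hA M) (hA y)
      _ = 2 * A := by ring

omit [NeZero q] in
/-- **Hyperbola step with a partial-sum bound `A`**: `|∑_{y < a ≤ N} χ(a)⌊N/a⌋| ≤ 2A ⌊N/(y+1)⌋`
(Pintz's (3.4)–(3.5) for `j = 1`). [cite: Pintz1977ElementaryVIII, Lemma 1 (3.5) p. 91] -/
theorem abs_sum_Ioc_reChar_mul_div_le_of_partialSum_le {A : ℝ} (hA : ∀ n, ‖partialSum χ n‖ ≤ A)
    (y N : ℕ) :
    |∑ a ∈ Ioc y N, reChar χ a * ((N / a : ℕ) : ℝ)| ≤ 2 * A * ((N / (y + 1) : ℕ) : ℝ) := by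
  rw [sum_Ioc_reChar_mul_div_eq]
  set K := N / (y + 1) with hK
  have hsplit := sum_Ioc_consecutive (fun b => ∑ a ∈ Ioc y (N / b), reChar χ a) (Nat.zero_le K)
    (Nat.div_le_self N (y + 1))
  rw [← hsplit]
  have hzero : ∑ b ∈ Ioc K N, ∑ a ∈ Ioc y (N / b), reChar χ a = 0 := by
    refine sum_eq_zero fun b hb => ?_
    have hKb : K < b := (mem_Ioc.mp hb).1
    have hb0 : 0 < b := lt_of_le_of_lt (Nat.zero_le K) hKb
    have h1 : N < b * (y + 1) := (Nat.div_lt_iff_lt_mul (Nat.succ_pos y)).mp hKb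
    have h2 : N / b < y + 1 := by
      rw [Nat.div_lt_iff_lt_mul hb0, mul_comm]
      exact h1
    rw [Finset.Ioc_eq_empty (by omega), sum_empty]
  rw [hzero, add_zero]
  calc |∑ b ∈ Ioc 0 K, ∑ a ∈ Ioc y (N / b), reChar χ a|
      ≤ ∑ b ∈ Ioc 0 K, |∑ a ∈ Ioc y (N / b), reChar χ a| := abs_sum_le_sum_abs _ _
    _ ≤ ∑ _b ∈ Ioc 0 K, (2 * A : ℝ) :=
        sum_le_sum fun b _ => abs_sum_Ioc_reChar_le_of_partialSum_le χ hA y (N / b)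
    _ = 2 * A * (K : ℝ) := by rw [sum_const, Nat.card_Ioc, nsmul_eq_mul, Nat.sub_zero]; ring

/-- The real form of the `L(1, χ)`-tail with a partial-sum bound `A`:
`|Re L(1,χ) − ∑_{a ≤ y} χ(a)/a| ≤ 2A/(y+1)`. [cite: MontgomeryVaughan2007, §11.2.1 Exercise 3(a)] -/
theorem abs_re_LFunction_one_sub_sum_le_of_partialSum_le (hχ : χ ≠ 1) {A : ℝ}
    (hA : ∀ n, ‖partialSum χ n‖ ≤ A) (y : ℕ) :
    |(χ.LFunction 1).re - ∑ a ∈ Ioc 0 y, reChar χ a / a| ≤ 2 * A / ((y : ℝ) + 1) := by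
  have h := norm_sum_div_sub_LFunction_one_le χ hχ hA y
  have hre : (∑ n ∈ range y, χ ((n + 1 : ℕ) : ZMod q) / ((n : ℂ) + 1)).re =
      ∑ a ∈ Ioc 0 y, reChar χ a / a := by
    rw [sum_Ioc_eq_sum_range_succ, Complex.re_sum]
    refine sum_congr rfl fun n _ => ?_
    rw [reChar_apply χ (Nat.succ_ne_zero n),
      show ((n : ℂ) + 1) = (((n + 1 : ℕ) : ℝ) : ℂ) by push_cast; ring, Complex.div_ofReal_re]
  calc |(χ.LFunction 1).re - ∑ a ∈ Ioc 0 y, reChar χ a / a|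
      = |((∑ n ∈ range y, χ ((n + 1 : ℕ) : ZMod q) / ((n : ℂ) + 1)) - χ.LFunction 1).re| := by
        rw [Complex.sub_re, hre, abs_sub_comm]
    _ ≤ ‖(∑ n ∈ range y, χ ((n + 1 : ℕ) : ZMod q) / ((n : ℂ) + 1)) - χ.LFunction 1‖ :=
        abs_re_le_norm _
    _ ≤ 2 * A / ((y : ℝ) + 1) := h

/-- **Pintz's Lemma 1 for `j = 1` with a partial-sum bound `A ≥ 1`** (Dirichlet's hyperbola
method): for real quadratic `χ ≠ χ₀` with `|∑_{n ≤ M} χ(n)| ≤ A` for all `M`, and `t ≥ A`,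
`|∑_{n ≤ t} (1 ∗ χ)(n) − L(1, χ) t| ≤ 5 √(A t)` (the printed (3.9): `y L₁(1) + O(√(A₁ y))`).
[cite: Pintz1977ElementaryVIII, Lemma 1 (3.3), (3.9) pp. 91–92] -/
theorem abs_sum_charDivisorSum_sub_le_of_partialSum_le (hχ : χ ≠ 1) {A : ℝ}
    (hA1 : 1 ≤ A) (hA : ∀ n, ‖partialSum χ n‖ ≤ A) {t : ℝ} (ht : A ≤ t) :
    |∑ n ∈ Ioc 0 ⌊t⌋₊, charDivisorSum χ n - (χ.LFunction 1).re * t| ≤ 5 * Real.sqrt (A * t) := by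
  set L := (χ.LFunction 1).re with hL
  have ht1 : 1 ≤ t := hA1.trans ht
  have ht0 : 0 < t := by linarith
  have hA0 : 0 < A := by linarith
  have hAt1 : 1 ≤ A * t := by nlinarith
  set s := Real.sqrt (A * t) with hs
  have hs1 : 1 ≤ s := by rw [hs]; exact Real.one_le_sqrt.mpr hAt1
  have hs0 : 0 < s := by linarith
  have hss : s * s = A * t := Real.mul_self_sqrt (by positivity)
  set N := ⌊t⌋₊ with hN
  set y := ⌊s⌋₊ with hy
  have hy1 : 1 ≤ y := Nat.le_floor (by simpa using hs1)
  have hyle : (y : ℝ) ≤ s := Nat.floor_le hs0.le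
  have hylt : s < y + 1 := Nat.lt_floor_add_one _
  have hNle : (N : ℝ) ≤ t := Nat.floor_le ht0.le
  have hst : s ≤ t := by nlinarith
  have hyN : y ≤ N := Nat.floor_mono hst
  rw [sum_charDivisorSum_eq, ← sum_Ioc_consecutive _ (Nat.zero_le y) hyN]
  -- the hyperbola part `a > y`
  have hApart : |∑ a ∈ Ioc y N, reChar χ a * ((N / a : ℕ) : ℝ)| ≤ 2 * s := by
    refine (abs_sum_Ioc_reChar_mul_div_le_of_partialSum_le χ hA y N).trans ?_
    have h1 : ((N / (y + 1) : ℕ) : ℝ) ≤ (N : ℝ) / ((y + 1 : ℕ) : ℝ) := Nat.cast_div_le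
    have h2 : (N : ℝ) / ((y + 1 : ℕ) : ℝ) ≤ t / s := by
      push_cast
      calc (N : ℝ) / ((y : ℝ) + 1) ≤ t / ((y : ℝ) + 1) := by gcongr
        _ ≤ t / s := by gcongr
    calc 2 * A * ((N / (y + 1) : ℕ) : ℝ) ≤ 2 * A * (t / s) :=
          mul_le_mul_of_nonneg_left (h1.trans h2) (by positivity)
      _ = 2 * s := by field_simp; nlinarith [hss]
  -- the fractional parts
  have hBpart : |∑ a ∈ Ioc 0 y, reChar χ a * ((N / a : ℕ) : ℝ) -
      t * ∑ a ∈ Ioc 0 y, reChar χ a / a| ≤ s := by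
    rw [mul_sum, ← sum_sub_distrib]
    calc |∑ a ∈ Ioc 0 y, (reChar χ a * ((N / a : ℕ) : ℝ) - t * (reChar χ a / a))|
        ≤ ∑ a ∈ Ioc 0 y, |reChar χ a * ((N / a : ℕ) : ℝ) - t * (reChar χ a / a)| :=
          abs_sum_le_sum_abs _ _
      _ ≤ ∑ _a ∈ Ioc 0 y, (1 : ℝ) := by
          refine sum_le_sum fun a _ => ?_
          rw [show reChar χ a * ((N / a : ℕ) : ℝ) - t * (reChar χ a / a) =
            reChar χ a * (((N / a : ℕ) : ℝ) - t / a) by ring, abs_mul]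
          calc |reChar χ a| * |((N / a : ℕ) : ℝ) - t / a| ≤ 1 * 1 :=
                mul_le_mul (abs_reChar_le_one χ a) (abs_natDiv_sub_div_le ht0.le a)
                  (abs_nonneg _) zero_le_one
            _ = 1 := one_mul _
      _ = y := by simp
      _ ≤ s := hyle
  -- the `L(1, χ)` tail
  have hCpart : |t * ∑ a ∈ Ioc 0 y, reChar χ a / a - L * t| ≤ 2 * s := by
    have h := abs_re_LFunction_one_sub_sum_le_of_partialSum_le χ hχ hA y
    rw [← hL] at h
    rw [show t * ∑ a ∈ Ioc 0 y, reChar χ a / a - L * t =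
      t * -(L - ∑ a ∈ Ioc 0 y, reChar χ a / a) by ring, abs_mul, abs_neg, abs_of_pos ht0]
    calc t * |L - ∑ a ∈ Ioc 0 y, reChar χ a / a| ≤ t * (2 * A / ((y : ℝ) + 1)) :=
          mul_le_mul_of_nonneg_left h ht0.le
      _ ≤ t * (2 * A / s) := by gcongr
      _ = 2 * s := by field_simp; nlinarith [hss]
  have key : ∑ a ∈ Ioc 0 y, reChar χ a * ((N / a : ℕ) : ℝ) +
      ∑ a ∈ Ioc y N, reChar χ a * ((N / a : ℕ) : ℝ) - L * t =
      (∑ a ∈ Ioc 0 y, reChar χ a * ((N / a : ℕ) : ℝ) - t * ∑ a ∈ Ioc 0 y, reChar χ a / a) +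
      (t * ∑ a ∈ Ioc 0 y, reChar χ a / a - L * t) +
      ∑ a ∈ Ioc y N, reChar χ a * ((N / a : ℕ) : ℝ) := by ring
  rw [key]
  calc _ ≤ |(∑ a ∈ Ioc 0 y, reChar χ a * ((N / a : ℕ) : ℝ) - t * ∑ a ∈ Ioc 0 y, reChar χ a / a) +
        (t * ∑ a ∈ Ioc 0 y, reChar χ a / a - L * t)| +
        |∑ a ∈ Ioc y N, reChar χ a * ((N / a : ℕ) : ℝ)| := abs_add_le _ _
    _ ≤ (s + 2 * s) + 2 * s := add_le_add ((abs_add_le _ _).trans (add_le_add hBpart hCpart)) hApart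
    _ = 5 * Real.sqrt (A * t) := by rw [hs]; ring

end HyperbolaPV

/-! ## Part D. `F(s) = ζ(s) L(s, χ)`: Page's theorem for a real primitive character (§4, p. 96) -/

section PagePrimitive

open DirichletAbel RealChar

variable {q : ℕ} [NeZero q] (χ : DirichletCharacter ℂ q)

omit [NeZero q] in
/-- `Finset.Icc 1 n = Finset.Ioc 0 n` in `ℕ`. [folklore] -/
private theorem Icc_one_eq_Ioc_zero (n : ℕ) : Finset.Icc 1 n = Finset.Ioc 0 n := by
  ext k; simp only [Finset.mem_Icc, Finset.mem_Ioc]; omega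

omit [NeZero q] in
/-- `r(4) ≥ 1` for `r = 1 ∗ χ`, `χ` quadratic: `r(4) = 1 + χ(2) + χ(2)²` with `χ(2) ∈ {0, ±1}`
(Pintz: "`f_i(l²) ≥ 1`", p. 95). [cite: Pintz1977ElementaryVIII, §4 p. 95] -/
theorem one_le_charDivisorSum_four (hq : χ ^ 2 = 1) : 1 ≤ charDivisorSum χ 4 := by
  have h := charDivisorSum_prime_pow χ hq Nat.prime_two 2
  rw [show (2 : ℕ) ^ 2 = 4 by norm_num] at h
  rw [h]
  simp only [Finset.sum_range_succ, Finset.sum_range_zero, zero_add, pow_zero, pow_one]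
  rcases reChar_trichotomy χ hq 2 with h2 | h2 | h2 <;> rw [h2] <;> norm_num

/-- **`ζ(s) L(s, χ) = ∑ r(n) n^{−s}`** on `Re s > 1` (`r = 1 ∗ χ`; Mathlib's `zetaMul`).
[cite: Pintz1977ElementaryVIII, §4 p. 94 ("F₁(s) = F(s, χ) = ζ(s) L(s, χ)")] -/
theorem zeta_mul_LFunction_eq_LSeries (hq : χ ^ 2 = 1) {s : ℂ} (hs : 1 < s.re) :
    riemannZeta s * χ.LFunction s = LSeries (fun n => ((charDivisorSum χ n : ℝ) : ℂ)) s := by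
  have h1 : LSeries (fun n => ((charDivisorSum χ n : ℝ) : ℂ)) s = LSeries (⇑χ.zetaMul) s :=
    LSeries_congr (fun {n} _ => ofReal_charDivisorSum χ hq n) s
  rw [h1, DirichletCharacter.zetaMul, ← ArithmeticFunction.coe_mul, LSeries_convolution']
  · rw [DirichletCharacter.LFunction_eq_LSeries χ hs,
      ← ArithmeticFunction.LSeries_zeta_eq_riemannZeta hs]
    congr 1
    exact LSeries_congr (fun {n} hn => χ.apply_eq_toArithmeticFunction_apply hn) s
  · exact ArithmeticFunction.LSeriesSummable_zeta_iff.mpr hs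
  · exact (LSeriesSummable_congr s fun {n} hn =>
      (χ.apply_eq_toArithmeticFunction_apply hn)).mp
        (DirichletCharacter.LSeriesSummable_of_one_lt_re χ hs)

/-- The entire function `G(s) = ζ₁(s) L(s, χ)` (`ζ₁ = (s−1)ζ(s)` completed) satisfies
`G(s) = (s − 1) ∑ r(n) n^{−s}` on `Re s > 1`. [cite: Pintz1977ElementaryVIII, §4 p. 94] -/
theorem zeta₁_mul_LFunction_eq (hq : χ ^ 2 = 1) {s : ℂ} (hs : 1 < s.re) :
    riemannZeta₁ s * χ.LFunction s =
      (s - 1) * LSeries (fun n => ((charDivisorSum χ n : ℝ) : ℂ)) s := by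
  have hs1 : s ≠ 1 := by intro h; rw [h] at hs; simp at hs
  have hs1' : s - 1 ≠ 0 := sub_ne_zero.mpr hs1
  rw [← zeta_mul_LFunction_eq_LSeries χ hq hs, riemannZeta_eq_inv_sub_mul hs1]
  field_simp

/-- `e⁴ < 55`. [folklore] -/
private theorem exp_four_lt_55 : Real.exp 4 < 55 := by
  have h4 : Real.exp 4 = Real.exp 1 ^ 4 := by rw [← Real.exp_nat_mul]; norm_num
  have e := Real.exp_one_lt_d9
  have e0 := Real.exp_pos 1
  have e2 : Real.exp 1 * Real.exp 1 < 2.7182818286 * 2.7182818286 := mul_lt_mul'' e e e0.le e0.le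
  have e4 : (Real.exp 1 * Real.exp 1) * (Real.exp 1 * Real.exp 1) <
      (2.7182818286 * 2.7182818286) * (2.7182818286 * 2.7182818286) :=
    mul_lt_mul'' e2 e2 (by positivity) (by positivity)
  rw [h4, show Real.exp 1 ^ 4 = (Real.exp 1 * Real.exp 1) * (Real.exp 1 * Real.exp 1) by ring]
  norm_num at e4; linarith

/-- The bracket of the error term on the window: for `1/4 ≤ α = σ − 1/2`, `0 ≤ σ ≤ 1`, `ℓ ≥ 0`,
`ℓ + 1/α + σ(ℓ/α + 1/α²) ≤ 5(ℓ + 4)`. [folklore] -/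
private theorem window_bracket_le {σ ℓ : ℝ} (hα4 : 1 / 4 ≤ σ - 1 / 2) (hσ1 : σ ≤ 1) (hℓ : 0 ≤ ℓ) :
    ℓ + 1 / (σ - 1 / 2) + σ * (ℓ / (σ - 1 / 2) + 1 / (σ - 1 / 2) ^ 2) ≤ 5 * (ℓ + 4) := by
  have hαpos : 0 < σ - 1 / 2 := by linarith
  have hσ0 : 0 ≤ σ := by linarith
  have h1 : 1 / (σ - 1 / 2) ≤ 4 := by
    rw [div_le_iff₀ hαpos]; linarith
  have h2 : ℓ / (σ - 1 / 2) ≤ 4 * ℓ := by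
    rw [div_le_iff₀ hαpos]
    have : ℓ * 1 ≤ ℓ * (4 * (σ - 1 / 2)) := mul_le_mul_of_nonneg_left (by linarith) hℓ
    linarith
  have h3 : 1 / (σ - 1 / 2) ^ 2 ≤ 16 := by
    have hsq : (1 / 4 : ℝ) ^ 2 ≤ (σ - 1 / 2) ^ 2 := pow_le_pow_left₀ (by norm_num) hα4 2
    rw [div_le_iff₀ (by positivity)]
    norm_num at hsq
    linarith
  have h4 : σ * (ℓ / (σ - 1 / 2) + 1 / (σ - 1 / 2) ^ 2) ≤ 1 * (4 * ℓ + 16) :=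
    mul_le_mul hσ1 (by linarith) (by positivity) zero_le_one
  linarith

/-- On the window `(1 − σ) log N ≤ 1`: `N^{−(σ − 1/2)} ≤ e · N^{−1/2}`. [folklore] -/
private theorem rpow_window_le {N σ : ℝ} (hN : 0 < N) (h : (1 - σ) * Real.log N ≤ 1) :
    N ^ (-(σ - 1 / 2)) ≤ Real.exp 1 * N ^ (-(1 / 2 : ℝ)) := by
  have e1 : N ^ (-(σ - 1 / 2)) = N ^ (1 - σ) * N ^ (-(1 / 2 : ℝ)) := by
    rw [← Real.rpow_add hN]; ring_nf
  rw [e1]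
  refine mul_le_mul_of_nonneg_right ?_ (Real.rpow_nonneg hN.le _)
  rw [Real.rpow_def_of_pos hN, Real.exp_le_exp]
  linarith [mul_comm (1 - σ) (Real.log N)]

/-- **`Re (ζ L(·,χ))′(σ) < 0` on the window** (Pintz's (4.5)): for a real primitive `χ` mod
`q ≥ 2`, `A = √q(1 + log q)`, `N ≥ 55`, `N ≥ A`, `25 e √A (log N + 4) < (log 4/4)√N` and
`1 − 1/log N ≤ σ < 1`, the function `ζ(s) L(s, χ)` has a derivative at `σ` with negative real part.
[cite: Pintz1977ElementaryVIII, proof of Theorems 4–5, (4.5) p. 96] -/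
theorem zeta_mul_LFunction_hasDerivAt_re_neg (hprim : χ.IsPrimitive) (hq : χ ^ 2 = 1) (hq2 : 2 ≤ q)
    {N : ℕ} (hN55 : 55 ≤ N) (hNA : Real.sqrt q * (1 + Real.log q) ≤ N)
    (herr : 25 * Real.exp 1 * Real.sqrt (Real.sqrt q * (1 + Real.log q)) * (Real.log N + 4) <
      Real.log 4 / 4 * Real.sqrt N)
    {σ : ℝ} (hσN : 1 - 1 / Real.log N ≤ σ) (hσ1 : σ < 1) :
    ∃ Φ' : ℂ, HasDerivAt (fun s : ℂ => riemannZeta s * χ.LFunction s) Φ' σ ∧ Φ'.re < 0 := by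
  -- the character is non-principal
  have hχ : χ ≠ 1 := by
    rintro rfl
    rw [DirichletCharacter.isPrimitive_def, DirichletCharacter.conductor_one] at hprim
    omega
  -- the data of the engine (kept opaque)
  obtain ⟨f, hfdef⟩ : ∃ f : ℕ → ℝ, ∀ n, f n = charDivisorSum χ n := ⟨_, fun _ => rfl⟩
  obtain ⟨a, hadef⟩ : ∃ a : ℝ, a = (χ.LFunction 1).re := ⟨_, rfl⟩
  obtain ⟨R, hR⟩ : ∃ R : ℝ → ℝ, ∀ t, R t = (∑ k ∈ Icc 1 ⌊t⌋₊, f k) - a * t := ⟨_, fun _ => rfl⟩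
  obtain ⟨I, hI⟩ : ∃ I : ℂ → ℂ,
      ∀ s, I s = ∫ t in Ioi (1 : ℝ), ((R t : ℝ) : ℂ) * (t : ℂ) ^ (-(s + 1)) := ⟨_, fun _ => rfl⟩
  have hff : f = fun n => charDivisorSum χ n := funext hfdef
  have hf : ∀ n, 0 ≤ f n := fun n => by rw [hfdef]; exact charDivisorSum_nonneg χ hq n
  have hf0 : f 0 = 0 := by rw [hfdef]; simp
  have hf4 : 1 ≤ f 4 := by rw [hfdef]; exact one_le_charDivisorSum_four χ hq
  have ha : 0 < a := by rw [hadef]; exact Siegel.LFunction_one_re_pos χ hχ hq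
  -- numerics of the window
  have hq1 : (1 : ℝ) ≤ q := by exact_mod_cast (le_trans (by norm_num) hq2)
  have hq0 : (0 : ℝ) < q := by linarith
  set A : ℝ := Real.sqrt q * (1 + Real.log q) with hAdef
  have hlogq : 0 ≤ Real.log q := Real.log_nonneg hq1
  have hA1 : 1 ≤ A := by
    have h1 : 1 ≤ Real.sqrt q := Real.one_le_sqrt.mpr hq1
    rw [hAdef]; nlinarith
  have hA0 : 0 < A := by linarith
  have hN1 : 1 ≤ N := le_trans (by norm_num) hN55
  have hN4 : 4 ≤ N := le_trans (by norm_num) hN55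
  have hN0r : (0 : ℝ) < N := by exact_mod_cast (lt_of_lt_of_le (by norm_num) hN1)
  have hN55r : (55 : ℝ) ≤ N := by exact_mod_cast hN55
  have hlogN4 : 4 ≤ Real.log N := by
    rw [← Real.log_exp 4]
    exact Real.log_le_log (Real.exp_pos 4) (by linarith [exp_four_lt_55])
  have hlogNpos : 0 < Real.log N := by linarith
  -- the two remainder bounds
  have hPV : ∀ n, ‖partialSum χ n‖ ≤ A := fun n => norm_partialSum_le_polyaVinogradov χ hq2 hprim n
  have hRb : ∀ t : ℝ, 1 ≤ t → |R t| ≤ 5 * q * t ^ (1 - (1 / 2 : ℝ)) := by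
    intro t ht
    have h := abs_sum_charDivisorSum_sub_le χ hχ hq (zero_lt_one.trans_le ht)
    rw [show (1 : ℝ) - 1 / 2 = 1 / 2 by norm_num, ← Real.sqrt_eq_rpow, hR, Icc_one_eq_Ioc_zero,
      hff, hadef]
    exact h
  have hB : ∀ t : ℝ, (N : ℝ) ≤ t → |R t| ≤ 5 * Real.sqrt A * t ^ (1 - (1 / 2 : ℝ)) := by
    intro t ht
    have hAt : A ≤ t := hNA.trans ht
    have h := abs_sum_charDivisorSum_sub_le_of_partialSum_le χ hχ hA1 hPV hAt
    rw [show (1 : ℝ) - 1 / 2 = 1 / 2 by norm_num, ← Real.sqrt_eq_rpow, hR, Icc_one_eq_Ioc_zero,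
      hff, hadef, mul_assoc, ← Real.sqrt_mul hA0.le]
    exact h
  -- the continued function `G = ζ₁ · L(χ)` and the identity `G = a s + s(s−1) I(s)` on `Re s > 1/2`
  obtain ⟨G, hG⟩ : ∃ G : ℂ → ℂ, ∀ s, G s = riemannZeta₁ s * χ.LFunction s := ⟨_, fun _ => rfl⟩
  have hGfun : G = fun s => riemannZeta₁ s * χ.LFunction s := funext hG
  have hGd : DifferentiableOn ℂ G {s : ℂ | 1 - (1 / 2 : ℝ) < s.re} := by
    rw [hGfun]
    exact (differentiable_riemannZeta₁.mul
      (DirichletCharacter.differentiable_LFunction hχ)).differentiableOn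
  have hGL : ∀ s : ℂ, 1 < s.re → G s = (s - 1) * LSeries (fun n => (f n : ℂ)) s := by
    intro s hs; rw [hG, hff]; exact zeta₁_mul_LFunction_eq χ hq hs
  have hκ : (0 : ℝ) ≤ 1 / 2 := by norm_num
  -- `ζ(s) L(s, χ) = Φ(s) := a s/(s−1) + s I(s)` off `s = 1` on the half-plane
  have hΦ : ∀ s : ℂ, 1 - (1 / 2 : ℝ) < s.re → s ≠ 1 →
      riemannZeta s * χ.LFunction s = a * s / (s - 1) + s * I s := by
    intro s hs hs1
    have hs1' : s - 1 ≠ 0 := sub_ne_zero.mpr hs1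
    have hGs := continuation_eq hf hR hRb hκ hI hGd hGL hs
    rw [hG] at hGs
    rw [riemannZeta_eq_inv_sub_mul hs1, mul_assoc, hGs]
    field_simp
  -- the point `σ`
  have h14 : 1 / Real.log N ≤ 1 / 4 := by
    rw [div_le_div_iff₀ hlogNpos (by norm_num)]; linarith
  have hσ34 : (3 : ℝ) / 4 ≤ σ := by linarith
  have hσκ : 1 - (1 / 2 : ℝ) < σ := by linarith
  have hσκ' : 1 - (1 / 2 : ℝ) < ((σ : ℂ)).re := by simpa using hσκ
  have hσ1' : (σ : ℂ) ≠ 1 := by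
    intro h; have := congrArg Complex.re h; simp at this; linarith
  have hD := hasDerivAt_continuation hR hRb hI hσκ' hσ1'
  refine ⟨_, hD.congr_of_eventuallyEq ?_, ?_⟩
  · -- `ζ · L` agrees with `Φ` near `σ`
    have hopen : IsOpen ({s : ℂ | 1 - (1 / 2 : ℝ) < s.re} ∩ {s : ℂ | s ≠ 1}) :=
      (isOpen_halfPlane _).inter isOpen_ne
    have hmem : (σ : ℂ) ∈ {s : ℂ | 1 - (1 / 2 : ℝ) < s.re} ∩ {s : ℂ | s ≠ 1} := ⟨hσκ', hσ1'⟩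
    filter_upwards [hopen.mem_nhds hmem] with s hs
    exact hΦ s hs.1 hs.2
  · have hle := re_deriv_le hf hf0 hf4 ha.le hR hRb hI hN4 hB hσκ (by linarith) hσ1 hσN
    have hα : σ + 1 / 2 - 1 = σ - 1 / 2 := by ring
    rw [hα] at hle
    have hα4 : (1 : ℝ) / 4 ≤ σ - 1 / 2 := by linarith
    have h1σ : (1 - σ) * Real.log N ≤ 1 := by
      have : 1 - σ ≤ 1 / Real.log N := by linarith
      calc (1 - σ) * Real.log N ≤ (1 / Real.log N) * Real.log N :=
            mul_le_mul_of_nonneg_right this hlogNpos.le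
        _ = 1 := by field_simp
    have hNpow := rpow_window_le hN0r h1σ
    have hbr := window_bracket_le (ℓ := Real.log N) hα4 hσ1.le hlogNpos.le
    have hsqrtN : Real.sqrt N * (N : ℝ) ^ (-(1 / 2 : ℝ)) = 1 := by
      rw [Real.sqrt_eq_rpow, ← Real.rpow_add hN0r]; norm_num
    have hbr0 : 0 ≤ Real.log N + 1 / (σ - 1 / 2) +
        σ * (Real.log N / (σ - 1 / 2) + 1 / (σ - 1 / 2) ^ 2) := by
      have hσ0 : 0 ≤ σ := by linarith
      have hαpos : 0 < σ - 1 / 2 := by linarith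
      positivity
    have hE : 5 * Real.sqrt A * (N : ℝ) ^ (-(σ - 1 / 2)) *
        (Real.log N + 1 / (σ - 1 / 2) + σ * (Real.log N / (σ - 1 / 2) + 1 / (σ - 1 / 2) ^ 2))
        < Real.log 4 / 4 := by
      calc 5 * Real.sqrt A * (N : ℝ) ^ (-(σ - 1 / 2)) *
          (Real.log N + 1 / (σ - 1 / 2) + σ * (Real.log N / (σ - 1 / 2) + 1 / (σ - 1 / 2) ^ 2))
          ≤ 5 * Real.sqrt A * (Real.exp 1 * (N : ℝ) ^ (-(1 / 2 : ℝ))) * (5 * (Real.log N + 4)) := by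
            gcongr
        _ = (25 * Real.exp 1 * Real.sqrt A * (Real.log N + 4)) * (N : ℝ) ^ (-(1 / 2 : ℝ)) := by
            ring
        _ < (Real.log 4 / 4 * Real.sqrt N) * (N : ℝ) ^ (-(1 / 2 : ℝ)) :=
            mul_lt_mul_of_pos_right herr (Real.rpow_pos_of_pos hN0r _)
        _ = Real.log 4 / 4 := by rw [mul_assoc, hsqrtN, mul_one]
    linarith

/-- **Page's theorem on the window `[1 − 1/log N, 1)` for a real PRIMITIVE character**
(Pintz 1977 VIII, proof of Theorem 4, p. 96): under the hypotheses of
`zeta_mul_LFunction_hasDerivAt_re_neg`, `L(s, χ)` has at most one real zero in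
`[1 − 1/log N, 1)`, and such a zero is simple ("`F(s)` has at most one, simple zero in the
interval `[1 − (1 − o(1))/log A, 1]`"). [cite: Pintz1977ElementaryVIII, Theorem 4 p. 90, proof p. 96] -/
theorem page_window_of_isPrimitive (hprim : χ.IsPrimitive) (hq : χ ^ 2 = 1) (hq2 : 2 ≤ q)
    {N : ℕ} (hN55 : 55 ≤ N) (hNA : Real.sqrt q * (1 + Real.log q) ≤ N)
    (herr : 25 * Real.exp 1 * Real.sqrt (Real.sqrt q * (1 + Real.log q)) * (Real.log N + 4) <
      Real.log 4 / 4 * Real.sqrt N) :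
    (∀ β₁ β₂ : ℝ, 1 - 1 / Real.log N ≤ β₁ → β₁ < 1 → 1 - 1 / Real.log N ≤ β₂ → β₂ < 1 →
        χ.LFunction (β₁ : ℂ) = 0 → χ.LFunction (β₂ : ℂ) = 0 → β₁ = β₂) ∧
      (∀ β : ℝ, 1 - 1 / Real.log N ≤ β → β < 1 → χ.LFunction (β : ℂ) = 0 →
        deriv χ.LFunction (β : ℂ) ≠ 0) := by
  have hχ : χ ≠ 1 := by
    rintro rfl
    rw [DirichletCharacter.isPrimitive_def, DirichletCharacter.conductor_one] at hprim
    omega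
  have hderiv : ∀ σ : ℝ, 1 - 1 / Real.log N ≤ σ → σ < 1 →
      ∃ Φ' : ℂ, HasDerivAt (fun s : ℂ => riemannZeta s * χ.LFunction s) Φ' σ ∧ Φ'.re < 0 :=
    fun σ h1 h2 => zeta_mul_LFunction_hasDerivAt_re_neg χ hprim hq hq2 hN55 hNA herr h1 h2
  refine ⟨?_, ?_⟩
  · intro β₁ β₂ h₁ h₁' h₂ h₂' hz₁ hz₂
    set lo : ℝ := 1 - 1 / Real.log N with hlo
    set hi : ℝ := max β₁ β₂ with hhi
    have hhi1 : hi < 1 := max_lt h₁' h₂'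
    have hF : ∀ σ : ℝ, σ ∈ Set.Icc lo hi →
        ∃ Φ' : ℂ, HasDerivAt (fun s : ℂ => riemannZeta s * χ.LFunction s) Φ' σ ∧ Φ'.re < 0 :=
      fun σ hσ => hderiv σ hσ.1 (lt_of_le_of_lt hσ.2 hhi1)
    choose! Φ' hΦ'd hΦ'neg using hF
    have hzero : ∀ β : ℝ, χ.LFunction (β : ℂ) = 0 →
        (fun s : ℂ => riemannZeta s * χ.LFunction s) (β : ℂ) = 0 := by
      intro β hβ; simp [hβ]
    exact eq_of_zeros_of_re_deriv_neg (F := fun s : ℂ => riemannZeta s * χ.LFunction s)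
      (F' := fun s => Φ' s.re) (lo := lo) (hi := hi)
      (fun σ hσ => by simpa using hΦ'd σ hσ) (fun σ hσ => by simpa using hΦ'neg σ hσ)
      ⟨h₁, le_max_left _ _⟩ ⟨h₂, le_max_right _ _⟩ (hzero β₁ hz₁) (hzero β₂ hz₂)
  · intro β hβ hβ1 hz
    obtain ⟨Φ', hΦ'd, hΦ'neg⟩ := hderiv β hβ hβ1
    have hβ1' : (β : ℂ) ≠ 1 := by
      intro h; have := congrArg Complex.re h; simp at this; linarith
    have hζ := (differentiableAt_riemannZeta hβ1').hasDerivAt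
    have hL := ((DirichletCharacter.differentiable_LFunction hχ) (β : ℂ)).hasDerivAt
    have hprod := hζ.mul hL
    have huniq : Φ' = deriv riemannZeta β * χ.LFunction β + riemannZeta β * deriv χ.LFunction β :=
      hΦ'd.unique hprod
    intro hd
    rw [hz, hd, mul_zero, mul_zero, add_zero] at huniq
    rw [huniq] at hΦ'neg
    simp at hΦ'neg

end PagePrimitive

/-! ## Part E. Theorem 4 (Page, `c = 2 + o(1)`): the choice `x = D^{1/(2−η)}` and the reduction of a
non-principal real character to the primitive character inducing it (p. 90, first paragraph) -/

section PageAssembly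

/-- `(1 + log x)/x^u → 0` (`u > 0`). [folklore] -/
private theorem tendsto_one_add_log_div_rpow {u : ℝ} (hu : 0 < u) :
    Tendsto (fun x : ℝ => (1 + Real.log x) / x ^ u) atTop (𝓝 0) := by
  have h1 : Tendsto (fun x : ℝ => x ^ (-u)) atTop (𝓝 0) := tendsto_rpow_neg_atTop hu
  have h2 := (isLittleO_log_rpow_atTop hu).tendsto_div_nhds_zero
  have h := h1.add h2
  rw [add_zero] at h
  refine h.congr' ?_
  filter_upwards [eventually_gt_atTop 0] with x hx
  rw [Real.rpow_neg hx.le, add_div, inv_eq_one_div]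

/-- **The three numerical conditions of Part D hold for `x = D^e`, `e > 1/2`, `D` large** (real
form): eventually `56 ≤ x^e`, `√x (1 + log x) ≤ x^e/2` and
`25 e (e+4) x^{1/4} (1 + log x)² < (log 4/4) x^{e/2}/√2`. [folklore] -/
private theorem eventually_page_conditions {e : ℝ} (he : 1 / 2 < e) :
    ∀ᶠ x : ℝ in atTop, 56 ≤ x ^ e ∧ Real.sqrt x * (1 + Real.log x) ≤ x ^ e / 2 ∧
      25 * Real.exp 1 * (e + 4) * (x ^ (1 / 4 : ℝ) * (1 + Real.log x) ^ 2) <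
        Real.log 4 / 4 * (x ^ (e / 2) / Real.sqrt 2) := by
  have he0 : 0 < e := by linarith
  have hlog4 : 0 < Real.log 4 := Real.log_pos (by norm_num)
  -- (i)
  have h1 : ∀ᶠ x : ℝ in atTop, 56 ≤ x ^ e := (tendsto_rpow_atTop he0).eventually_ge_atTop 56
  -- (ii)
  have hu : 0 < e - 1 / 2 := by linarith
  have h2 : ∀ᶠ x : ℝ in atTop, (1 + Real.log x) / x ^ (e - 1 / 2) < 1 / 2 :=
    (tendsto_order.1 (tendsto_one_add_log_div_rpow hu)).2 _ (by norm_num)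
  -- (iii)
  have hδ : 0 < (e / 2 - 1 / 4) / 2 := by linarith
  set c₀ : ℝ := Real.log 4 / 4 / (Real.sqrt 2 * (25 * Real.exp 1 * (e + 4))) with hc₀
  have hc₀pos : 0 < c₀ := by rw [hc₀]; positivity
  have h3 : ∀ᶠ x : ℝ in atTop, (1 + Real.log x) / x ^ ((e / 2 - 1 / 4) / 2) < Real.sqrt c₀ :=
    (tendsto_order.1 (tendsto_one_add_log_div_rpow hδ)).2 _ (Real.sqrt_pos.mpr hc₀pos)
  filter_upwards [h1, h2, h3, eventually_ge_atTop (1 : ℝ)] with x hx1 hx2 hx3 hx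
  have hx0 : 0 < x := by linarith
  have hlogx : 0 ≤ Real.log x := Real.log_nonneg hx
  refine ⟨hx1, ?_, ?_⟩
  · have hpos : 0 < x ^ (e - 1 / 2) := Real.rpow_pos_of_pos hx0 _
    rw [div_lt_iff₀ hpos] at hx2
    have hsplit : x ^ e = Real.sqrt x * x ^ (e - 1 / 2) := by
      rw [Real.sqrt_eq_rpow, ← Real.rpow_add hx0]; ring_nf
    rw [hsplit]
    have hs : 0 ≤ Real.sqrt x := Real.sqrt_nonneg x
    nlinarith [mul_le_mul_of_nonneg_left hx2.le hs]
  · have hpos : 0 < x ^ ((e / 2 - 1 / 4) / 2) := Real.rpow_pos_of_pos hx0 _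
    rw [div_lt_iff₀ hpos] at hx3
    have h1l : 0 ≤ 1 + Real.log x := by linarith
    -- square: `(1 + log x)² < c₀ x^{e/2 - 1/4}`
    have hsq : (1 + Real.log x) ^ 2 < c₀ * x ^ (e / 2 - 1 / 4) := by
      have hm := mul_lt_mul'' hx3 hx3 h1l h1l
      have e1 : Real.sqrt c₀ * x ^ ((e / 2 - 1 / 4) / 2) * (Real.sqrt c₀ * x ^ ((e / 2 - 1 / 4) / 2)) =
          c₀ * x ^ (e / 2 - 1 / 4) := by
        have : x ^ ((e / 2 - 1 / 4) / 2) * x ^ ((e / 2 - 1 / 4) / 2) = x ^ (e / 2 - 1 / 4) := by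
          rw [← Real.rpow_add hx0]; ring_nf
        calc _ = (Real.sqrt c₀ * Real.sqrt c₀) * (x ^ ((e / 2 - 1 / 4) / 2) *
            x ^ ((e / 2 - 1 / 4) / 2)) := by ring
          _ = c₀ * x ^ (e / 2 - 1 / 4) := by rw [Real.mul_self_sqrt hc₀pos.le, this]
      rw [pow_two, ← e1]; exact hm
    have hx14 : 0 < x ^ (1 / 4 : ℝ) := Real.rpow_pos_of_pos hx0 _
    have hsplit : x ^ (e / 2) = x ^ (1 / 4 : ℝ) * x ^ (e / 2 - 1 / 4) := by
      rw [← Real.rpow_add hx0]; ring_nf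
    have hK : 0 < 25 * Real.exp 1 * (e + 4) := by positivity
    calc 25 * Real.exp 1 * (e + 4) * (x ^ (1 / 4 : ℝ) * (1 + Real.log x) ^ 2)
        < 25 * Real.exp 1 * (e + 4) * (x ^ (1 / 4 : ℝ) * (c₀ * x ^ (e / 2 - 1 / 4))) := by
          gcongr
      _ = Real.log 4 / 4 * (x ^ (e / 2) / Real.sqrt 2) := by
          rw [hsplit, hc₀]; field_simp

/-- **The conditions of Part D at `N = ⌊D^e⌋`, `e > 1/2`, for all large `D`** (and the
monotonicity `A(q) ≤ A(D)` for `q ≤ D` is used by the caller): there is `D₀` such that for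
`D ≥ D₀`, `N = ⌊D^e⌋ ≥ 55`, `√D(1 + log D) ≤ N` and `25 e √(√D(1+log D)) (log N + 4) < (log 4/4)√N`.
[folklore] -/
private theorem exists_page_conditions_nat {e : ℝ} (he : 1 / 2 < e) :
    ∃ D₀ : ℕ, ∀ D : ℕ, D₀ ≤ D →
      55 ≤ ⌊(D : ℝ) ^ e⌋₊ ∧ Real.sqrt D * (1 + Real.log D) ≤ ⌊(D : ℝ) ^ e⌋₊ ∧
        25 * Real.exp 1 * Real.sqrt (Real.sqrt D * (1 + Real.log D)) *
            (Real.log (⌊(D : ℝ) ^ e⌋₊ : ℕ) + 4) <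
          Real.log 4 / 4 * Real.sqrt (⌊(D : ℝ) ^ e⌋₊ : ℕ) := by
  have he0 : 0 < e := by linarith
  obtain ⟨x₀, hx₀⟩ := Filter.eventually_atTop.mp
    ((eventually_page_conditions he).and (eventually_ge_atTop (1 : ℝ)))
  refine ⟨⌈x₀⌉₊, fun D hD => ?_⟩
  have hDx : x₀ ≤ (D : ℝ) := (Nat.le_ceil x₀).trans (by exact_mod_cast hD)
  obtain ⟨⟨h56, hA, herr⟩, hD1⟩ := hx₀ D hDx
  have hD0 : (0 : ℝ) < D := by linarith
  have hlogD : 0 ≤ Real.log D := Real.log_nonneg hD1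
  set y : ℝ := (D : ℝ) ^ e with hy
  have hy0 : 0 < y := Real.rpow_pos_of_pos hD0 _
  set N := ⌊y⌋₊ with hN
  have hN55 : 55 ≤ N := Nat.le_floor (by push_cast; linarith)
  have hNy : (N : ℝ) ≤ y := Nat.floor_le hy0.le
  have hNgt : y - 1 < N := by
    have := Nat.lt_floor_add_one y; linarith
  have hNhalf : y / 2 ≤ N := by linarith
  have hN0 : (0 : ℝ) < N := by linarith
  have hN1 : (1 : ℝ) ≤ N := by linarith
  refine ⟨hN55, hA.trans hNhalf, ?_⟩
  -- `log N ≤ e log D`, `√(√D(1+log D)) ≤ D^{1/4}(1 + log D)`, `√N ≥ D^{e/2}/√2`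
  have hlogN : Real.log N ≤ e * Real.log D := by
    calc Real.log N ≤ Real.log y := Real.log_le_log hN0 hNy
      _ = e * Real.log D := by rw [hy, Real.log_rpow hD0]
  have hlogN4 : Real.log N + 4 ≤ (e + 4) * (1 + Real.log D) := by nlinarith
  have hsqrtA : Real.sqrt (Real.sqrt D * (1 + Real.log D)) ≤ (D : ℝ) ^ (1 / 4 : ℝ) * (1 + Real.log D) := by
    have h1 : 1 ≤ 1 + Real.log D := by linarith
    rw [Real.sqrt_le_left (by positivity)]
    have hD14 : ((D : ℝ) ^ (1 / 4 : ℝ)) ^ 2 = Real.sqrt D := by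
      rw [Real.sqrt_eq_rpow, ← Real.rpow_natCast, ← Real.rpow_mul hD0.le]
      norm_num
    rw [mul_pow, hD14]
    have : 1 + Real.log D ≤ (1 + Real.log D) ^ 2 := by nlinarith
    exact mul_le_mul_of_nonneg_left this (Real.sqrt_nonneg _)
  have hsqrtN : (D : ℝ) ^ (e / 2) / Real.sqrt 2 ≤ Real.sqrt N := by
    have h1 : (D : ℝ) ^ (e / 2) / Real.sqrt 2 = Real.sqrt (y / 2) := by
      rw [Real.sqrt_div' _ (by norm_num : (0 : ℝ) ≤ 2)]
      congr 1
      rw [hy, Real.sqrt_eq_rpow, ← Real.rpow_mul hD0.le]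
      ring_nf
    rw [h1]
    exact Real.sqrt_le_sqrt hNhalf
  have hlog4 : 0 < Real.log 4 := Real.log_pos (by norm_num)
  calc 25 * Real.exp 1 * Real.sqrt (Real.sqrt D * (1 + Real.log D)) * (Real.log N + 4)
      ≤ 25 * Real.exp 1 * ((D : ℝ) ^ (1 / 4 : ℝ) * (1 + Real.log D)) * ((e + 4) * (1 + Real.log D)) := by
        gcongr
    _ = 25 * Real.exp 1 * (e + 4) * ((D : ℝ) ^ (1 / 4 : ℝ) * (1 + Real.log D) ^ 2) := by ring
    _ < Real.log 4 / 4 * ((D : ℝ) ^ (e / 2) / Real.sqrt 2) := herr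
    _ ≤ Real.log 4 / 4 * Real.sqrt N := by gcongr

variable {D : ℕ} [NeZero D] (χ : DirichletCharacter ℂ D)

omit [NeZero D] in
/-- The Euler factors removed when passing to the primitive character do not vanish at a real
point `β > 0`: `∏_{p ∣ D} (1 − χ₁(p) p^{−β}) ≠ 0`. [folklore] -/
private theorem eulerFactors_ne_zero {q₁ : ℕ} (χ₁ : DirichletCharacter ℂ q₁) {β : ℝ} (hβ : 0 < β) :
    ∏ p ∈ D.primeFactors, (1 - χ₁ p * (p : ℂ) ^ (-(β : ℂ))) ≠ 0 := by
  refine Finset.prod_ne_zero_iff.mpr fun p hp => ?_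
  have hp2 : 2 ≤ p := (Nat.prime_of_mem_primeFactors hp).two_le
  have hp0 : (0 : ℝ) < p := by exact_mod_cast (lt_of_lt_of_le (by norm_num) hp2)
  have hlt : ‖χ₁ p * (p : ℂ) ^ (-(β : ℂ))‖ < 1 := by
    rw [norm_mul, show (-(β : ℂ)) = ((-β : ℝ) : ℂ) by push_cast; ring, ← Complex.ofReal_natCast,
      ← Complex.ofReal_cpow hp0.le, Complex.norm_real, Real.norm_eq_abs,
      abs_of_pos (Real.rpow_pos_of_pos hp0 _)]
    have h1 : ‖χ₁ p‖ ≤ 1 := χ₁.norm_le_one p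
    have h2 : (p : ℝ) ^ (-β) < 1 :=
      Real.rpow_lt_one_of_one_lt_of_neg (by exact_mod_cast (lt_of_lt_of_le (by norm_num) hp2))
        (by linarith)
    calc ‖χ₁ p‖ * (p : ℝ) ^ (-β) ≤ 1 * (p : ℝ) ^ (-β) :=
          mul_le_mul_of_nonneg_right h1 (Real.rpow_nonneg hp0.le _)
      _ < 1 := by rw [one_mul]; exact h2
  intro h
  have : χ₁ p * (p : ℂ) ^ (-(β : ℂ)) = 1 := by linear_combination -h
  rw [this, norm_one] at hlt
  exact lt_irrefl _ hlt

/-- **Reduction to the primitive character** ("if `χ` is induced by the primitive `χ₁ (mod D₁)`,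
then `L(s, χ)` and `L(s, χ₁)` have the same zeros for `Re s > 0`", p. 90): for `χ ≠ χ₀` mod `D`
with primitive character `χ₁` and real `β > 0`, `L(β, χ) = 0 ↔ L(β, χ₁) = 0`, and at such a zero
`L′(β, χ) = L′(β, χ₁) · ∏_{p ∣ D}(1 − χ₁(p)p^{−β})` with a non-zero Euler factor.
[cite: Pintz1977ElementaryVIII, §2 p. 90] -/
theorem LFunction_zero_iff_primitive [NeZero χ.conductor] (hχ : χ ≠ 1) {β : ℝ} (hβ : 0 < β) :
    (χ.LFunction (β : ℂ) = 0 ↔ χ.primitiveCharacter.LFunction (β : ℂ) = 0) ∧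
      (χ.primitiveCharacter.LFunction (β : ℂ) = 0 →
        (deriv χ.LFunction (β : ℂ) ≠ 0 ↔ deriv χ.primitiveCharacter.LFunction (β : ℂ) ≠ 0)) := by
  have hχ₁ne : χ.primitiveCharacter ≠ 1 := by
    intro h
    apply hχ
    rw [← DirichletCharacter.changeLevel_primitiveCharacter χ, h, map_one]
  -- `L(s, χ) = L(s, χ₁) · P(s)` for all `s`
  have hfun : χ.LFunction = fun s => χ.primitiveCharacter.LFunction s *
      ∏ p ∈ D.primeFactors, (1 - χ.primitiveCharacter p * (p : ℂ) ^ (-s)) := by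
    funext s
    have h := DirichletCharacter.LFunction_changeLevel χ.conductor_dvd_level χ.primitiveCharacter
      (s := s) (Or.inl hχ₁ne)
    rw [DirichletCharacter.changeLevel_primitiveCharacter] at h
    exact h
  have hP := eulerFactors_ne_zero (D := D) χ.primitiveCharacter hβ
  have hPdiff : DifferentiableAt ℂ (fun s : ℂ => ∏ p ∈ D.primeFactors,
      (1 - χ.primitiveCharacter p * (p : ℂ) ^ (-s))) (β : ℂ) := by
    refine DifferentiableAt.fun_finsetProd fun p hp => ?_
    have hp0 : (p : ℂ) ≠ 0 := by exact_mod_cast (Nat.prime_of_mem_primeFactors hp).ne_zero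
    exact (differentiableAt_const _).sub ((differentiableAt_const _).mul
      (differentiableAt_id.neg.const_cpow (Or.inl hp0)))
  have hL₁diff : DifferentiableAt ℂ χ.primitiveCharacter.LFunction (β : ℂ) :=
    (DirichletCharacter.differentiable_LFunction hχ₁ne) _
  constructor
  · rw [hfun]
    simp only [mul_eq_zero]
    exact ⟨fun h => h.resolve_right hP, fun h => Or.inl h⟩
  · intro h0
    have hd : deriv χ.LFunction (β : ℂ) = deriv χ.primitiveCharacter.LFunction (β : ℂ) *
        ∏ p ∈ D.primeFactors, (1 - χ.primitiveCharacter p * (p : ℂ) ^ (-(β : ℂ))) := by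
      rw [hfun, deriv_fun_mul hL₁diff hPdiff, h0, zero_mul, add_zero]
    rw [hd]
    exact ⟨fun h => fun h' => h (by rw [h', zero_mul]), fun h => mul_ne_zero h hP⟩

end PageAssembly

end Pintz1977RealZeros

/-! ## Part F. The discharge `pintz1977RealZeros_theorem4_holds` -/

open Pintz1977RealZeros in
/-- **Pintz 1977 (VIII), Theorem 4 (Page's theorem with `c = 2 + o(1)`) — PROVED.** For every
`η > 0` there is `D₀` such that for `D ≥ D₀` and `χ` a real non-principal character mod `D`, two
distinct real zeros of `L(s, χ)` satisfy `min ≤ 1 − (2 − η)/log D`, and a real zero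
`β ≥ 1 − (2 − η)/log D` is simple. Road (as printed, §§3–4 with the Pólya–Vinogradov input
`A = √D (1 + log D)` of the tree): the continued function `F(s) = ζ(s)L(s, χ₁)` of the inducing
primitive character has `Re F′(σ) < 0` on `[1 − 1/log N, 1)` for `N = ⌊D^{1/(2−η)}⌋` and `D` large,
hence at most one, simple real zero there; the window `[1 − (2−η)/log D, 1)` is contained in it.
[cite: Pintz1977ElementaryVIII, Theorem 4 p. 90, proof p. 96] -/
theorem pintz1977RealZeros_theorem4_holds : pintz1977RealZeros_theorem4 := by
  intro η hη
  by_cases hη2 : 2 ≤ η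
  · -- trivial range `η ≥ 2`: the window is empty (real zeros are `< 1`)
    refine ⟨0, fun D _ _ χ hquad hχ => ?_⟩
    have hlt1 : ∀ b : ℝ, χ.LFunction (b : ℂ) = 0 → b < 1 := by
      intro b hb
      by_contra hcon
      exact DirichletCharacter.LFunction_ne_zero_of_one_le_re χ (Or.inl hχ)
        (s := (b : ℂ)) (by simpa using not_lt.1 hcon) hb
    have hlogD : 0 ≤ Real.log D := Real.log_natCast_nonneg D
    have hwin : 1 ≤ 1 - (2 - η) / Real.log D := by
      have : (2 - η) / Real.log D ≤ 0 := div_nonpos_of_nonpos_of_nonneg (by linarith) hlogD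
      linarith
    refine ⟨fun β₁ β₂ _ h₁ _ => ?_, fun β hβ hwβ => ?_⟩
    · exact (min_le_left _ _).trans ((hlt1 β₁ h₁).le.trans hwin)
    · have := hlt1 β hβ; linarith
  · push Not at hη2
    set e : ℝ := 1 / (2 - η) with hedef
    have h2η : 0 < 2 - η := by linarith
    have he : 1 / 2 < e := by
      rw [hedef, div_lt_div_iff₀ (by norm_num) h2η]; linarith
    have he0 : 0 < e := by linarith
    obtain ⟨D₀, hD₀⟩ := exists_page_conditions_nat he
    refine ⟨max D₀ 2, fun D _ hD χ hquad hχ => ?_⟩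
    have hDD₀ : D₀ ≤ D := le_trans (le_max_left _ _) hD
    have hD2 : 2 ≤ D := le_trans (le_max_right _ _) hD
    obtain ⟨hN55, hNA, herr⟩ := hD₀ D hDD₀
    set N := ⌊(D : ℝ) ^ e⌋₊ with hNdef
    have hD0 : (0 : ℝ) < D := by exact_mod_cast lt_of_lt_of_le (by norm_num) hD2
    have hD1 : (1 : ℝ) < D := by exact_mod_cast lt_of_lt_of_le (by norm_num) hD2
    have hlogD : 0 < Real.log D := Real.log_pos hD1
    -- the primitive character
    haveI : NeZero χ.conductor := ⟨DirichletCharacter.conductor_ne_zero χ⟩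
    have hprim : χ.primitiveCharacter.IsPrimitive :=
      DirichletCharacter.primitiveCharacter_isPrimitive χ
    have hsq : χ ^ 2 = 1 := MulChar.IsQuadratic.sq_eq_one hquad
    have hsq₁ : χ.primitiveCharacter ^ 2 = 1 := by
      apply DirichletCharacter.changeLevel_injective χ.conductor_dvd_level
      rw [map_pow, map_one, DirichletCharacter.changeLevel_primitiveCharacter χ, hsq]
    have hD₁2 : 2 ≤ χ.conductor := by
      have h1 : χ.conductor ≠ 1 := fun h =>
        hχ (DirichletCharacter.eq_one_iff_conductor_eq_one.mpr h)
      have h0 : χ.conductor ≠ 0 := DirichletCharacter.conductor_ne_zero χ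
      omega
    have hD₁D : χ.conductor ≤ D :=
      Nat.le_of_dvd (Nat.pos_of_ne_zero (NeZero.ne D)) χ.conductor_dvd_level
    -- the conditions of Part D at level `D₁ ≤ D`
    have hD₁r : (χ.conductor : ℝ) ≤ D := by exact_mod_cast hD₁D
    have hD₁1 : (1 : ℝ) ≤ χ.conductor := by exact_mod_cast le_trans (by norm_num) hD₁2
    have hA₁A : Real.sqrt χ.conductor * (1 + Real.log χ.conductor) ≤
        Real.sqrt D * (1 + Real.log D) := by
      gcongr
    have hNA₁ : Real.sqrt χ.conductor * (1 + Real.log χ.conductor) ≤ N := hA₁A.trans hNA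
    have hlogD₁ : 0 ≤ Real.log χ.conductor := Real.log_nonneg hD₁1
    have herr₁ : 25 * Real.exp 1 * Real.sqrt (Real.sqrt χ.conductor * (1 + Real.log χ.conductor)) *
        (Real.log N + 4) < Real.log 4 / 4 * Real.sqrt N := by
      refine lt_of_le_of_lt ?_ herr
      have hN1 : (1 : ℝ) ≤ N := by exact_mod_cast le_trans (by norm_num) hN55
      have : 0 ≤ Real.log N + 4 := by linarith [Real.log_nonneg hN1]
      gcongr
    have hpage := page_window_of_isPrimitive χ.primitiveCharacter hprim hsq₁ hD₁2 hN55 hNA₁ herr₁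
    -- the window `[1 − (2−η)/log D, 1)` lies inside `[1 − 1/log N, 1)` and inside `(0, 1)`
    have hN55r : (55 : ℝ) ≤ N := by exact_mod_cast hN55
    have hN0 : (0 : ℝ) < N := by linarith
    have hNle : (N : ℝ) ≤ (D : ℝ) ^ e := Nat.floor_le (Real.rpow_nonneg hD0.le _)
    have hlogN : Real.log N ≤ e * Real.log D := by
      calc Real.log N ≤ Real.log ((D : ℝ) ^ e) := Real.log_le_log hN0 hNle
        _ = e * Real.log D := Real.log_rpow hD0 e
    have hlogNpos : 0 < Real.log N := Real.log_pos (by linarith)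
    have hwindow : 1 - 1 / Real.log N ≤ 1 - (2 - η) / Real.log D := by
      have : (2 - η) / Real.log D ≤ 1 / Real.log N := by
        rw [div_le_div_iff₀ hlogD hlogNpos]
        have : e * (2 - η) = 1 := by rw [hedef]; field_simp
        nlinarith
      linarith
    have hwinpos : 0 < 1 - (2 - η) / Real.log D := by
      have hlogN4 : 4 ≤ Real.log N := by
        rw [← Real.log_exp 4]
        exact Real.log_le_log (Real.exp_pos 4) (by linarith [exp_four_lt_55])
      have : 1 / Real.log N ≤ 1 / 4 := by
        rw [div_le_div_iff₀ hlogNpos (by norm_num)]; linarith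
      linarith
    have hlt1 : ∀ b : ℝ, χ.LFunction (b : ℂ) = 0 → b < 1 := by
      intro b hb
      by_contra hcon
      exact DirichletCharacter.LFunction_ne_zero_of_one_le_re χ (Or.inl hχ)
        (s := (b : ℂ)) (by simpa using not_lt.1 hcon) hb
    refine ⟨fun β₁ β₂ hne h₁ h₂ => ?_, fun β hβ hwβ => ?_⟩
    · -- two distinct zeros: not both in the window
      by_contra hcon
      push Not at hcon
      have hb₁ : 1 - (2 - η) / Real.log D < β₁ := lt_of_lt_of_le hcon (min_le_left _ _)
      have hb₂ : 1 - (2 - η) / Real.log D < β₂ := lt_of_lt_of_le hcon (min_le_right _ _)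
      have hz₁ := ((LFunction_zero_iff_primitive χ hχ (by linarith : (0 : ℝ) < β₁)).1).mp h₁
      have hz₂ := ((LFunction_zero_iff_primitive χ hχ (by linarith : (0 : ℝ) < β₂)).1).mp h₂
      exact hne (hpage.1 β₁ β₂ (by linarith) (hlt1 β₁ h₁) (by linarith) (hlt1 β₂ h₂) hz₁ hz₂)
    · -- a zero in the window is simple
      have hβ0 : (0 : ℝ) < β := by linarith
      have hred := LFunction_zero_iff_primitive χ hχ hβ0
      have hz := hred.1.mp hβ
      exact (hred.2 hz).mpr (hpage.2 β (by linarith) (hlt1 β hβ) hz)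
end Literature.NumberTheory.LFunctions
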